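import Summits.CriticalPhenomena.Ising3DConformalLimit.Theses.PerfectScreening
import Summits.CriticalPhenomena.Ising3DConformalLimit.Theses.PlantedPinning
import Summits.CriticalPhenomena.Ising3DConformalLimit.Theses.LeeYangGap
import Summits.CriticalPhenomena.Ising3DConformalLimit.Theses.SubPtolemyInterlacing
import Summits.CriticalPhenomena.Ising3DConformalLimit.Theses.EnergyNotSigmaSquared
import Summits.CriticalPhenomena.Ising3DConformalLimit.Theses.HyperoctahedralRP
import Summits.CriticalPhenomena.Ising3DConformalLimit.Theses.CoerciveSharpness
import Summits.CriticalPhenomena.Ising3DConformalLimit.Theses.AnomalousForcesInteraction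
import Summits.CriticalPhenomena.Ising3DConformalLimit.Theses.GammaForcesInteraction
import Summits.CriticalPhenomena.Ising3DConformalLimit.Theses.DiracCensus
import Summits.CriticalPhenomena.Ising3DConformalLimit.Theorems.PerfectScreeningMoebiusLimitExistsTwoLeaf
import Summits.CriticalPhenomena.Ising3DConformalLimit.Theorems.PerfectScreeningMoebiusLimitExistsSketchReduction
import Summits.CriticalPhenomena.Ising3DConformalLimit.Theorems.EnergyNotSigmaSquaredMoebiusLimitExistsHrpFactorisation
import Summits.CriticalPhenomena.Ising3DConformalLimit.Theorems.PlantedPinningMoebiusLimitExistsWardDoor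
import Summits.CriticalPhenomena.Ising3DConformalLimit.Theorems.PlantedPinningMoebiusLimitExistsWeakTranslation
import Summits.CriticalPhenomena.Ising3DConformalLimit.Theorems.PlantedPinningMoebiusLimitExistsWardOnU0
import Summits.CriticalPhenomena.Ising3DConformalLimit.Theorems.PlantedPinningMoebiusLimitExistsWardOfWardOnU0
import Summits.CriticalPhenomena.Ising3DConformalLimit.Theorems.PlantedPinningMoebiusLimitExistsWardLowLevels
import Summits.CriticalPhenomena.Ising3DConformalLimit.Theorems.PlantedPinningMoebiusLimitExistsWardOfWardDir
import Summits.CriticalPhenomena.Ising3DConformalLimit.Theorems.MoebiusLimitExists.Negative.MeshContinuity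
import Summits.CriticalPhenomena.Ising3DConformalLimit.Theorems.LeeYangGapMoebiusLimitExistsLatticeK1Door
import Summits.CriticalPhenomena.Ising3DConformalLimit.Theorems.PlantedPinningMoebiusLimitExistsK1DoorTight
import Summits.CriticalPhenomena.Ising3DConformalLimit.Theorems.PlantedPinningMoebiusLimitExistsNonCoincidentPathConnected
import Summits.CriticalPhenomena.Ising3DConformalLimit.Theorems.PlantedPinningMoebiusLimitExistsGoodFrame
import Summits.CriticalPhenomena.Ising3DConformalLimit.Theorems.PlantedPinningMoebiusLimitExistsWardOfPointwise
import Summits.CriticalPhenomena.Ising3DConformalLimit.Theorems.PlantedPinningMoebiusLimitExistsPointwiseOfWard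
import Summits.CriticalPhenomena.Ising3DConformalLimit.Theorems.PlantedPinningMoebiusLimitExistsLocalWard
import Summits.CriticalPhenomena.Ising3DConformalLimit.Theorems.PlantedPinningMoebiusLimitExistsDefectRotate
import Summits.CriticalPhenomena.Ising3DConformalLimit.Theorems.PlantedPinningMoebiusLimitExistsDefectPerm
import Summits.CriticalPhenomena.Ising3DConformalLimit.Theorems.PlantedPinningMoebiusLimitExistsRotationGenerator
import Summits.CriticalPhenomena.Ising3DConformalLimit.Theorems.PlantedPinningMoebiusLimitExistsDefectTranslate
import Summits.CriticalPhenomena.Ising3DConformalLimit.Theorems.PlantedPinningMoebiusLimitExistsDefectDilate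
import Summits.CriticalPhenomena.Ising3DConformalLimit.Theorems.PlantedPinningMoebiusLimitExistsJetVanishing
import Summits.CriticalPhenomena.Ising3DConformalLimit.Theorems.PlantedPinningMoebiusLimitExistsSquareTwist
import Summits.CriticalPhenomena.Ising3DConformalLimit.Theorems.PlantedPinningMoebiusLimitExistsLineDeriv
import Summits.CriticalPhenomena.Ising3DConformalLimit.Theorems.EnergyNotSigmaSquaredMoebiusLimitExistsOneMapOneJetAnalyticity
import Summits.CriticalPhenomena.Ising3DConformalLimit.Theorems.PlantedPinningMoebiusLimitExistsDefectSymmetry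
import Summits.CriticalPhenomena.Ising3DConformalLimit.Theorems.PlantedPinningMoebiusLimitExistsJetDoor
import Summits.CriticalPhenomena.Ising3DConformalLimit.Theorems.PlantedPinningMoebiusLimitExistsSquareJet
import Summits.CriticalPhenomena.Ising3DConformalLimit.Theorems.PlantedPinningMoebiusLimitExistsRegularPolygon
import Summits.CriticalPhenomena.Ising3DConformalLimit.Theorems.PlantedPinningMoebiusLimitExistsRegularPolygonRotation
import Summits.CriticalPhenomena.Ising3DConformalLimit.Theorems.PlantedPinningMoebiusLimitExistsCyclicAveraging
import Summits.CriticalPhenomena.Ising3DConformalLimit.Theorems.PlantedPinningMoebiusLimitExistsInvariantDeriv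
import Summits.CriticalPhenomena.Ising3DConformalLimit.Theorems.PlantedPinningMoebiusLimitExistsJetCompEquiv
import Summits.CriticalPhenomena.Ising3DConformalLimit.Theorems.PlantedPinningMoebiusLimitExistsMultilinearBasis
import Summits.CriticalPhenomena.Ising3DConformalLimit.Theorems.PlantedPinningMoebiusLimitExistsHessianKernel
import Summits.CriticalPhenomena.Ising3DConformalLimit.Theorems.PlantedPinningMoebiusLimitExistsEulerAt
import Summits.CriticalPhenomena.Ising3DConformalLimit.Theorems.PlantedPinningMoebiusLimitExistsAxialRotationGenerator
import Summits.CriticalPhenomena.Ising3DConformalLimit.Theorems.PlantedPinningMoebiusLimitExistsRegularPolygonReflection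
import Mathlib.Analysis.SpecialFunctions.Trigonometric.Basic
import Mathlib.Analysis.Calculus.ContDiff.Operations
import Mathlib.LinearAlgebra.Multilinear.Basis
import Mathlib.Analysis.Calculus.FDeriv.Symmetric
import Mathlib.Analysis.Calculus.ContDiff.Defs
import Literature.Probability.LatticeModels.CriticalScalingDimension
import Literature.Probability.LatticeModels.SCTWardIdentity
import Literature.MathematicalPhysics.QuantumFieldTheory.PointwiseOSReconstruction
import HarnessLib
import HarnessLib.Audit

/-!
# Line `Sketch` for crux `MoebiusLimitExists` (stmt-CriticalPhenomena-1344) — skeleton v28 = v27 + the `_of` spellings of routes CoerciveSharpness, AnomalousForcesInteraction, GammaForcesInteraction, DiracCensus (lead c21); ONE sorry = residual 7⁗_jet≥2,odd ≡ item 1982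

v28 (lead prover-line-stmt-CriticalPhenomena-1344-c21-0, route CoerciveSharpness, 2026-08-17T18:3xZ) changes NO stub: the registered residual is still
7⁗_jet≥2,odd `MoebiusLimitExistsSketchV22.stub_interiorWardK1JetGeTwoOdd` (≡ item stmt-1982 by p167057).  It only adds, in namespace
`MoebiusLimitExistsSketchV11`, the conclusions BY NAME for the four further routes of this seat's payload that file the crux verbatim
(`coerciveSharpness_MoebiusLimit_of`, `anomalousForcesInteraction_MoebiusLimit_of`, `gammaForcesInteraction_MoebiusLimit_of`,
`diracCensus_MoebiusLimitExists_of`; all the same term), so that the audit block shows the crux concluded by name on every sharing route.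
Upstream at v28: items 1981 (⟺ 6150 ∧ 4659), 1982, 4671, 4840 OPEN; 1980 proved; Disproof gen 4 unchanged; the split of 1344 into its leaves is
prepared by planners (LeeYangGap 16:50Z two-leaf; CoerciveSharpness three-leaf, glue landed `Theorems/CoerciveSharpnessMoebiusLimitSplit.lean`).
-----
v27 header:

# (v27) Line `Sketch` for crux `MoebiusLimitExists` (stmt-CriticalPhenomena-1344) — skeleton v27 = v26 with wave 4 LANDED (N1c p168081): waves 1–4 = 10/10 stubs landed; ONE sorry = residual 7⁗_jet≥2,odd ≡ item 1982 (lead c20)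

v24 adds, in namespace `MoebiusLimitExistsSketchV24`: (pure) the `K_{e₀}` defect is invariant under isometries fixing `e₀`
(`defectK1_axial_invariant`) and its jet at a symmetric configuration is invariant under the stabiliser (`jetK1_comp_symmetry`, P1) —
at `P_n` the dihedral `D_n`-equivariance of every Taylor coefficient; (Ising₃ limits) the three first-order identities of the defect near
any non-coincident configuration — translation `DD_n(y)[ĉ] = 0`, Euler `DD_n(y)[y] = (1 − nΔ)D_n(y)` (E1 `stub_fderiv_self_of_homogeneous_at`),
axial rotation `DD_n(y)[M̂y] = 0` (Z3' `stub_fderiv_axialRotationGenerator`) — and, by K0 `stub_hessian_apply_eq_zero_of_fderiv_identity`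
(differentiating such an identity at a critical point), the ORDER-2 KERNELS at every `x₀` with `DD_n(x₀) = 0` (e.g. `P_n`): the Hessian of
`D_n` kills `ĉ`, `x₀` and `M̂x₀` in either slot (`limit_hessian_defectK1_kernels`).  Wave 3 = K0, E1, Z3'.  The registered residual is
unchanged (7⁗_jet≥2,odd); §K documents which of its `(n, 2)` entries are free.
-----
v23 header:

v22 adds, in namespace `MoebiusLimitExistsSketchV22` (PURE — any `O(3)`-invariant level, no limit hypothesis): the `K_{e₀}` defect is ODD
under the height reflection `ẑ` (Z1 with the reflection in `e₀^⊥`), hence at every configuration in `e₀^⊥` its Taylor jet is odd,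
`D^kD(x₀)[ẑm] = −D^kD(x₀)[m]` (P1 `stub_iteratedFDeriv_comp_continuousLinearEquiv`: jets compose with continuous linear equivalences, no
smoothness needed), so every standard-basis Taylor coefficient `∂ᵏD/∂x_{i₁a₁}⋯∂x_{i_ka_k}(x₀)` with an EVEN number of vertical slots
`aⱼ = 0` vanishes (`jetK1_basis_eq_zero_of_even_vertical`), and the order-`k` jet vanishes iff its ODD-parity basis coefficients do (P2
`stub_multilinear_eq_zero_of_basis`: `Module.Basis.ext_multilinear`).  Registered residual **7⁗_jet≥2,odd `stub_interiorWardK1JetGeTwoOdd`**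
(held): at the unit regular horizontal `n`-gon, even `n ≥ 4`, `k ≥ 2`, the odd-parity basis coefficients of `D_n` vanish; 7⁗_jet≥2 is
DERIVED; wave 2 = P1, P2.  At `(n,k) = (4,2)`: only the mixed horizontal–vertical Hessian block of `D_4` at the square is left (c19's count).
-----
v21 header:
(lead prover-line-stmt-CriticalPhenomena-1344-c20-0, 2026-08-17T14:0xZ, HONEST re-audit gen 1, 23rd lead seat, route PlantedPinning,
bet route SubPtolemyInterlacing; v16–v19 by lead c19, v11–v15 by leads c17/c18).

v19 (c19) had ONE registered `sorry`, 7⁗_jet `MoebiusLimitExistsSketchV16.stub_interiorWardK1Jet`: at each even level `n ≥ 4` the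
Taylor jet of the pointwise `K_{e₀}` defect `D_n(x) = DS_n(x)[(‖xᵢ‖²e₀ − 2⟪e₀,xᵢ⟫xᵢ)ᵢ] − 2Δ(Σ⟪e₀,xᵢ⟫)S_n(x)` of the limit vanishes
at ONE non-coincident configuration; c19 proved orders `0` and `1` of that jet FREE at the horizontal square (`n = 4` only, by three
explicit families of free zeros whose directions span `(ℝ³)⁴`).  v20 (this file) proves ORDER-1 FREENESS AT EVERY LEVEL by one
uniform mechanism, TRANSITIVITY, and moves the base point of the residual to the regular horizontal `n`-gon:

**A. Registered pure stubs (wave 1 of c20, stub-workers):** N1a `stub_regularPolygon_mem_nonCoincident` (the unit regular horizontal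
`n`-gon `P_n i = cos(2πi/n) e₁ + sin(2πi/n) e₂` is non-coincident), N1b `stub_regularPolygon_rotation` (a linear isometry of `ℝ³`
fixing `e₀` maps `P_n i ↦ P_n (i+1)` — the rotation by `2π/n` about the `e₀`-axis), N2 `stub_cyclicInvariant_eq_zero` (a linear
functional on `ℝⁿ` invariant under the cyclic shift and killing `(1,…,1)` is `0` — averaging over a transitive group), N3
`stub_fderiv_apply_eq_of_invariant` (`D(x₀ + δ) = D(x₀ + Tδ)` for a continuous linear `T` ⇒ `DD(x₀)[δ] = DD(x₀)[Tδ]`).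
**B. Lead assembly** (`limit_fderiv_defectK1_eq_zero_of_cyclicSymmetry`): for every normalised non-degenerate Euclidean scale-covariant
Ising₃ limit, every level `n`, and every non-coincident configuration `x₀` lying in a plane `⊥ e₀` which a linear isometry `R`
with `R e₀ = e₀` maps to its cyclic relabelling (`R x₀ᵢ = x₀_{i+1}`): `fderiv D_n x₀ = 0`.  Proof: the covector `ℓ = DD_n(x₀)`
(i) kills every constant-height direction (free zeros II of `…DefectSymmetry.lean`: `D_n` vanishes on configurations in planes `⊥ e₀`,
Y3), (ii) is invariant under `T : δ ↦ (R̂δ)∘σ⁻¹` (covector principle Z1 + Z2 read at `x₀ + δ`, then N3); on vertical directions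
`δ = (hᵢ e₀)ᵢ` the map `T` is the cyclic shift of `h`, so by N2 with (i) for `h = (1,…,1)`, `ℓ` kills all vertical directions; every
direction is constant-height + vertical.  Hence orders `0` AND `1` of 7⁗_jet are FREE at `P_n` for EVERY `n`
(`limit_jetK1_order_le_one_eq_zero_at_regularPolygon`, N1a + N1b), generalising c19's square (`P_4`).
**C. The registered residual 7⁗_jet≥2 `stub_interiorWardK1JetGeTwo` (held by the lead)**: same hypotheses as 7⁗_jet, conclusion: at
every even level `n ≥ 4` the iterated derivatives of ORDER `k ≥ 2` of `D_n` vanish AT `P_n`.  7⁗_jet is DERIVED (orders `0, 1` by B,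
base point `P_n` by N1a), then v19 verbatim; TIGHTNESS `crux ⟺ 1981 ∧ 7⁗_jet≥2` (`crux_iff_entry_and_jetK1GeTwoStub`, through c19's
`jetK1_everywhere_of_jetK1EvenGeFour`), so the reshape drops no content.  CONTENT of 7⁗_jet≥2: the Taylor coefficients of order `≥ 2`
of ONE real-analytic scalar function at ONE explicit configuration per even level — the first of them (order 2 at the square) being
the first conformal datum of the Ising₃ four-point function (c19's count: ≤ 2 symmetry-unforced Hessian entries).  No mechanism is claimed.

Stubs: closed (v11–v19) W0 W1 P1 P2 C1 C2 Z1–Z5 J1 Y1 Y3 + tightness/anchor files, (v20 wave 1, c20) N1a p165159 N1b p165192 N2 p165289 N3 p165147 /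
open 7⁗_jet≥2 (held) / delegated — / STUCK 7⁗_jet≥2 ≡ 7⁗_jet ≡ item 1982 (the conjecture content).  Disproof.lean (cdisprove gen 4, unchanged since
2026-08-16T05:14Z, "resists", no `_false_without_`, no `-- Targets` entry biting 7⁗_jet≥2, which is crux-implied) honoured as in v15–v19.

------------------------------------------------------------------------------------------------------------------------------------
v19 header (c19), kept for the record:

# Line `Sketch` for crux `MoebiusLimitExists` (stmt-CriticalPhenomena-1344) — skeleton v19 = v16 "SYMMETRY-PROTECTED ZEROS of the SCT defect + the JET door" + §E order-1 freeness at the square; waves 1 and 2 LANDED; ONE sorry 7⁗_jet (lead c19)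
(lead prover-line-stmt-CriticalPhenomena-1344-c19-0, 2026-08-17T12:3xZ, HONEST re-audit gen 1, 22nd lead seat, route PlantedPinning,
bet route SubPtolemyInterlacing; v11–v15 by leads c17/c18).

v15 (c18) had ONE registered `sorry`, 7⁗_loc `MoebiusLimitExistsSketchV13.stub_interiorWardK1Local`: at each even level `n ≥ 4` the weak
`K_{e₀}` Ward identity on SOME non-empty open set of configurations (local-to-global by real-analyticity, p157368; tight, p157754).
v16 (this file) adds two layers of TRUE structure around that residual and sharpens it once more:

**A. Symmetries and FREE ZEROS of the pointwise defect** `E_b(F)(x) := DF(x)[(‖xᵢ‖²b − 2⟪b,xᵢ⟫xᵢ)ᵢ] − 2Δ(Σᵢ⟪b,xᵢ⟫)F(x)` of one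
level `F : (ℝ³)ⁿ → ℝ` (pure analysis, registered stubs Z1–Z5, waved to stub-workers):
* Z1 `stub_defect_rotate`: `E_{Rb}(F)(R̂x) = E_b(F)(x)` for `F ∘ R̂ = F`, `R ∈ O(3)`;  Z2 `stub_defect_perm`: `E_b(F)(x∘σ) = E_b(F)(x)` for
  `F ∘ σ̂ = F`;  Z3 `stub_fderiv_rotationGenerator`: `DF(x)[(⟪c,xᵢ⟫b − ⟪b,xᵢ⟫c)ᵢ] = 0` for `O(3)`-invariant `F` (the generator `M_{bc}`);
  Z4 `stub_defect_translate`: **the defect is TRANSLATION INVARIANT**, `E_b(F)(x + ĉ) = E_b(F)(x)`, for translation-invariant `F` with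
  the Euler identity `DF(x)[x] = −nΔF(x)` and `M_{bc}F = 0` at `x` — the conformal-algebra relation `[P_a, K_b] = 2δ_{ab}D − 2M_{ab}`
  (Di Francesco–Mathieu–Sénéchal (4.19)) read on the defect;  Z5 `stub_defect_dilate`: `E_b(F)(t x) = t^{1−nΔ} E_b(F)(x)`.
  Consequences (lead, file `…DefectSymmetry.lean`): the zero set of `E(F)` is a union of orbits of the similarity group, and the FREE ZEROS —
  `E_b(F)(x) = 0` for ALL `b` at every CENTRALLY SYMMETRIC configuration (`x∘σ = 2p̂ − x`), and `E_v(F)(x) = 0` at every configuration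
  COPLANAR in a plane `⊥ v` — for every `O(3) × S_n`-invariant translation-invariant scale-covariant `C¹` level, in particular for every
  level of every Euclidean scale-covariant Ising₃ limit (no Ward identity assumed).  These say exactly which configurations / which
  components of the `K`-Ward identity carry NO conformal content.
**B. The JET door** (pure analysis stub J1 `stub_eventuallyEq_zero_of_jet`, waved: an analytic function with vanishing Taylor jet at a
point vanishes near it — `HasFPowerSeriesOnBall.hasSum_iteratedFDeriv`), and the new registered residual
**7⁗_jet `stub_interiorWardK1Jet` (held by the lead)**: at each even level `n ≥ 4` there is ONE non-coincident configuration `x₀` at which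
ALL iterated Fréchet derivatives of the `K_{e₀}` defect of `S n` vanish.  7⁗_loc is DERIVED (`MoebiusLimitExistsSketchV13.stub_interiorWardK1Local`
below: analyticity of the limit p157368 + J1 + C1 p157117), then v15 verbatim (7⁗_loc ⇒ 7⁗ ⇒ 7″ ⇒ 7′ ⇒ 1982 ⇒ crux given 1981, all route
spellings BY NAME).  Tightness `crux ⟺ 1981 ∧ 7⁗_jet` (lead, file `…JetDoor.lean`): the whole conformal content of the Ising₃ `σ`-sector is
the TAYLOR JET of one scalar real-analytic function at ONE configuration per even level — and by A, at a centrally symmetric coplanar `x₀`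
(e.g. the horizontal square at `n = 4`) the order-0 coefficient and a computable part of every order are protected by `O(3) × S_n`.

Stubs: closed (v11–v15) W0 W1 P1 P2 C1 C2 + tightness files, (v16 wave 1, c19) Z1 p160640 Z2 p160639 Z3 p160916 Z4 p160616 Z5 p160758 J1 p160597 / open 7⁗_jet (held) / delegated — / STUCK 7⁗_jet ≡ 7⁗_loc ≡ item 1982
(the conjecture content; no mechanism claimed).  Disproof.lean (cdisprove gen 4, unchanged since 2026-08-16T05:14Z) honoured as in v15.

------------------------------------------------------------------------------------------------------------------------------------
v15 header (c18), kept for the record: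

# Line `Sketch` for crux `MoebiusLimitExists` (stmt-CriticalPhenomena-1344) — skeleton v15 "one generator, even levels, NEAR ONE CONFIGURATION; local-to-global landed" (lead c18)
(lead prover-line-stmt-CriticalPhenomena-1344-c18-0, 2026-08-17T10:4xZ, HONEST re-audit gen 1, 21st lead seat, route PlantedPinning,
bet route SubPtolemyInterlacing; v11/v11b by lead c17).  v12 = v11b with the two free stubs W0 `stub_wardLowLevels` (p154617) and
W1 `stub_wardOfWardDir` (p154558) LANDED and imported (tightness p155423 `…K1DoorTight.lean`).  v13 (this file) RESHAPES the residual
once more, by LOCAL-TO-GLOBAL: every Euclidean scale-covariant Ising₃ limit is REAL-ANALYTIC on the whole (connected) configuration space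
(nine-mirror analyticity p121553 transported by a good rotation), so the weak `K_{e₀}` Ward identity near ONE configuration propagates
to all configurations (identity theorem for the analytic pointwise defect `DS_n·K_{e₀} − 2Δ σ_{e₀} S_n`).  Registered stubs of v13:
7⁗_loc `MoebiusLimitExistsSketchV13.stub_interiorWardK1Local` (held: the `K_{e₀}` identity on SOME non-empty open set of
configurations at each even level `n ≥ 4`), and four pure-analysis stubs P1 `stub_nonCoincident_pathConnected`, P2 `stub_exists_goodFrame`,
C1 `stub_ward_of_pointwise`, C2 `stub_pointwise_of_ward` (wave 1 of c18 — ALL FOUR LANDED: p156713, p156669, p157117, p156884; v14 imports them);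
7⁗ is DERIVED (`MoebiusLimitExistsSketchV13.k1EvenGeFour_of_local`); the lead's local-to-global layer is LANDED (p157368
`Theorems/PlantedPinningMoebiusLimitExistsLocalWard.lean`: `analyticOnNhd_limit`, `ward_of_localWard`); v15 has ONE registered `sorry`, 7⁗_loc.

v10 (c16, "Ward door") had ONE registered stub 7″ `stub_interiorWardUpgradeStrict`: every normalised non-degenerate Euclidean
scale-covariant pointwise limit of the critical `ℤ³` Ising correlators on the interacting open-window stratum satisfies the weak
special-conformal Ward identities `∀ n, SCTWardWeak S Δ n` (≡ item 1982 ≡ 7′, tightness p149203; crux ⟺ 1981 ∧ 7″).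
v11 strips the provably FREE content out of 7″ and registers the irreducible residual:

* **7⁗ `stub_interiorWardK1EvenGeFour` (registered, held by the lead — the residual)**: same hypotheses as 7″, conclusion the weak
  Ward identity for the SINGLE generator `K_{e₀}`, `e₀ = EuclideanSpace.single 0 1`, at EVEN levels `n ≥ 4` only.  This is the
  infinitesimal form of "the Euclidean group and ONE special conformal transformation generate the Möbius group": under `O(3)`
  invariance `K_{Rb}(Rx) = R K_b(x)` turns the `K_{e₀}` identity into every `K_b` identity (W1), and the levels `n ∈ {0, 2}` and all
  odd `n` carry no information for these limits (W0: `S₀` is constant, `S_odd ≡ 0` by `limit_odd_eq_zero'`, `S₂ = C‖x−y‖^{−2Δ}` is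
  inversion covariant by `inversion_two_of_covariantLimit`, whence Ward at level 2 by the landed level-wise converse F2∘F1∘F0).
  CONTENT of 7⁗: the conformal Ward identity of the Ising₃ `σ`-sector for one generator on `S₄, S₆, …` — what ONE lattice
  observable (a discrete `K₁`-current / one component of a discrete stress tensor on `ℤ³`) would have to deliver.  No mechanism is
  claimed; nothing in tree or print supplies one (c14 §6, c16).
* **W1 `stub_wardOfWardDir` (LANDED p154558 — pure analysis)**: for ONE level: `O(3)` invariance of `F` + the weak `K_{b₀}`
  identity for one `b₀ ≠ 0` ⇒ the weak `K_b` identity for every `b` (rotation pullback of the Ward functional; `R̂ : x ↦ (R xᵢ)ᵢ` is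
  a measure-preserving homeomorphism of `(ℝ³)ⁿ` preserving `NonCoincident`; homogeneity in `b`).
* **W0 `stub_wardLowLevels` (LANDED p154617 — model-specific but free)**: for every normalised Euclidean scale-covariant
  pointwise limit of `criticalCorr 3`, `SCTWardWeak S Δ n` holds for `n < 4` and for all odd `n`.
* 7″ := W0 + W1 + 7⁗ (`stub_interiorWardUpgradeStrict`, v10's registered signature, DERIVED); then v10 verbatim: 7″ ⇒ 7′ ⇒ item 1982;
  compositions concluding the crux BY NAME (`MoebiusLimitExists_of` PerfectScreening, `plantedPinning_…`, `leeYangGap_…`,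
  `subPtolemyInterlacing_…`, `MoebiusLimit_of` EnergyNotSigmaSquared); **TIGHTNESS** `crux_iff_entry_and_k1Stub : crux ⟺ 1981 ∧ 7⁗`
  (crux ⇒ 7″ landed via p114842 + F, 7″ ⇒ 7⁗ by specialisation; ⇐ through W0, W1 and the door), so the reshape drops no content.
* **Lattice entrance (v11b, twin instance B's landed p152646/p153032)**: `MoebiusLimitExistsLatticeWard.k1Ward_iff_latticeK1Ward` converts 7⁗,
  test pair by test pair, into 7⁗_lat — the ASYMPTOTIC LATTICE single-generator Ward identity of the rescaled critical correlators
  `∫ ρ(δ)ⁿ ⟨σ_[x₁/δ]⋯σ_[xₙ/δ]⟩_{β_c} 𝒦ᵀ_{e₀}φ(x) dx → 0` (δ → 0⁺), even `n ≥ 4`; `stub_interiorWardK1EvenGeFour_of_lattice` is the door a discrete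
  `K₁` Ward identity on `ℤ³` would enter by, and `crux_iff_entry_and_latticeK1Stub : crux ⟺ 1981 ∧ 7⁗_lat` the census line.

Stubs: closed S1 S2 S3a S3b (a1), FEGC 1–6, 6a 6b 6c (c11), edge + reduction (p139739), census anchors (c12), 14-spelling glue (p137285,
p142965), Ward door glue (p145428), F0 (p148718), F1 (p148779), F2 (p146830), tightness (p149203), lattice doors (p152646, p153032),
W0 (p154617), W1 (p154558) / open 7⁗ / delegated — / STUCK 7⁗ (the single-generator 3D-Ising conformal Ward identity at even levels ≥ 4; no mechanism claimed).

Disproof.lean (cdisprove gen 4, unchanged since 2026-08-16T05:14Z) honoured: `crux_iff_inversion`, `crux_iff_normalised`,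
`moebiusLimit_iff_rotation_inversion_ge_four` (§A⁗ — the pointwise form of "content starts at even `n ≥ 4`", here in Ward form),
`cruxWithoutLimit_holds`; verdict "resists"; no `_false_without_` theorem; no `-- Targets` entry bites 7″/7⁗ (7⁗ is crux-implied).
-/

noncomputable section

open Filter Topology MeasureTheory
open Literature.Probability.LatticeModels Literature.MathematicalPhysics.QuantumFieldTheory
open EuclideanGeometry
open Set Function
open Summit.CriticalPhenomena.Ising3DConformalLimit.MoebiusLimitExistsOneMapOneJet
  (GoodConfig mirrorNormals stub_nineMirrorAnalyticity single_mem_mirrorNormals linearIndependent_single)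

namespace Summit.CriticalPhenomena.Ising3DConformalLimit.MoebiusLimitExistsSketchV22

open Summit.CriticalPhenomena.Ising3DConformalLimit.MoebiusLimitExistsSketchV16 (stub_defect_rotate)
open Summit.CriticalPhenomena.Ising3DConformalLimit.MoebiusLimitExistsDefectSymmetry (defect_neg_left)

/-! ## v22 §P-stubs. Registered pure stubs P1, P2 (wave 2 of lead c20) and the registered residual 7⁗_jet≥2,odd (held) -/

/-! P1 `stub_iteratedFDeriv_comp_continuousLinearEquiv` LANDED p166830 (`Theorems/PlantedPinningMoebiusLimitExistsJetCompEquiv.lean`), P2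
`stub_multilinear_eq_zero_of_basis` LANDED p166842 (`…MultilinearBasis.lean`) — wave 2 of lead c20 (two stub-workers, one message, both
`stub-landed` within 3 min), in this namespace, imported above. -/

/-- **STUB 7⁗_jet≥2,odd (XXL, THE HARDEST — held by the lead) — `stub_interiorWardK1JetGeTwoOdd`.**  For a normalised non-degenerate
Euclidean scale-covariant pointwise scaling limit of the critical `ℤ³` Ising correlators on the interacting open-window stratum (window,
`U₄ ≢ 0`, pointwise OS along the axes and clustering as FREE hypotheses), at every EVEN level `n ≥ 4`, every order `k ≥ 2` and every
string of coordinate indices `(i₁,a₁),…,(i_k,a_k) ∈ Fin n × Fin 3` containing an ODD number of vertical slots `aⱼ = 0`, the Taylor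
coefficient `∂ᵏD_n/∂x_{i₁a₁}⋯∂x_{i_ka_k}` of the pointwise `K_{e₀}` defect `D_n(x) = DS_n(x)[(‖xᵢ‖²e₀ − 2⟪e₀,xᵢ⟫xᵢ)ᵢ] − 2Δ(Σ⟪e₀,xᵢ⟫)S_n(x)`
vanishes AT THE UNIT REGULAR HORIZONTAL `n`-GON `P_n`.  The even-parity coefficients vanish by PARITY (§P, the jet is odd under the height
reflection), orders `0, 1` by transitivity (v20 §B), so this is 7⁗_jet≥2 (P2), 7⁗_jet, and the crux given item 1981; it is crux-implied
(tight).  CONTENT: the conformal Ward identity of the Ising₃ `σ`-sector as an explicit list of NUMBERS — at `(n, k) = (4, 2)` the mixed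
horizontal–vertical Hessian entries of `D_4` at the square.  No mechanism is claimed. [cite: FrancescoMathieuSenechal1997, §4.3.1 (4.51)–(4.54); DelamotteTissierWschebor2016, §5–6] -/
theorem stub_interiorWardK1JetGeTwoOdd :
    ∀ (ρ : ℝ → ℝ) (Δ : ℝ) (S : CorrFamily 3), (∀ δ ∈ Set.Ioc (0:ℝ) 1, 0 < ρ δ) →
      HasPointwiseScalingLimit (criticalCorr 3) ρ S → (∀ n z, z ∉ NonCoincident 3 n → S n z = 0) →
      IsNondegenerateTwoPoint S → IsEuclideanInvariant S → IsScaleCovariant Δ S →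
      1 / 2 < Δ → Δ ≤ 3 / 4 → HasNontrivialU4 S →
      (∀ τ : Fin 3, PointwiseOSReconstruction τ S) →
      (∀ (n m : ℕ) (x : Fin n → EuclideanSpace ℝ (Fin 3)) (y : Fin m → EuclideanSpace ℝ (Fin 3))
        (v : EuclideanSpace ℝ (Fin 3)), v ≠ 0 →
        Tendsto (fun t : ℝ => S (n + m) (Fin.append x (fun j => y j + t • v)) - S n x * S m y)
          atTop (𝓝 0)) →
      ∀ n, 4 ≤ n → Even n → ∀ k : ℕ, 2 ≤ k → ∀ idx : Fin k → Fin n × Fin 3,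
        Odd (Finset.univ.filter fun j => (idx j).2 = 0).card →
        iteratedFDeriv ℝ k (fun x : Fin n → EuclideanSpace ℝ (Fin 3) =>
          fderiv ℝ (S n) x (fun i => ‖x i‖ ^ 2 • (EuclideanSpace.single 0 1 : EuclideanSpace ℝ (Fin 3)) -
            (2 * inner ℝ (EuclideanSpace.single 0 1 : EuclideanSpace ℝ (Fin 3)) (x i)) • x i) -
          2 * Δ * (∑ i, inner ℝ (EuclideanSpace.single 0 1 : EuclideanSpace ℝ (Fin 3)) (x i)) * S n x)
          (fun i : Fin n => Real.cos (2 * Real.pi * ((i : ℕ) : ℝ) / (n : ℝ)) • (EuclideanSpace.single 1 1 : EuclideanSpace ℝ (Fin 3)) +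
            Real.sin (2 * Real.pi * ((i : ℕ) : ℝ) / (n : ℝ)) • (EuclideanSpace.single 2 1 : EuclideanSpace ℝ (Fin 3)))
          (fun j => Pi.single (idx j).1 (EuclideanSpace.single (idx j).2 (1:ℝ))) = 0 := by
  sorry

/-! ## P. PARITY of the `K_{e₀}`-defect jet under the height reflection (pure: any `O(3)`-invariant level) -/

/-- **The `K_{e₀}` defect of an `O(3)`-invariant level is ODD under the height reflection** `ẑ : (xᵢ)ᵢ ↦ (Z xᵢ)ᵢ`, `Z` the reflection
in the plane `e₀^⊥` (Z1 with `R = Z`, `Z e₀ = −e₀`, and `E_{−b} = −E_b`): `E_{e₀}(F)(ẑ x) = −E_{e₀}(F)(x)` for every configuration `x`.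
[cite: FrancescoMathieuSenechal1997, §4.1 (4.18)–(4.19)] -/
theorem defectK1_heightReflection (n : ℕ) (F : (Fin n → EuclideanSpace ℝ (Fin 3)) → ℝ) (Δ : ℝ)
    (hrot : ∀ (R : EuclideanSpace ℝ (Fin 3) ≃ₗᵢ[ℝ] EuclideanSpace ℝ (Fin 3)) (y : Fin n → EuclideanSpace ℝ (Fin 3)),
      F (fun i => R (y i)) = F y)
    (x : Fin n → EuclideanSpace ℝ (Fin 3)) :
    fderiv ℝ F (fun i => (ℝ ∙ (EuclideanSpace.single 0 1 : EuclideanSpace ℝ (Fin 3)))ᗮ.reflection (x i))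
        (fun i => ‖(ℝ ∙ (EuclideanSpace.single 0 1 : EuclideanSpace ℝ (Fin 3)))ᗮ.reflection (x i)‖ ^ 2 •
            (EuclideanSpace.single 0 1 : EuclideanSpace ℝ (Fin 3)) -
          (2 * inner ℝ (EuclideanSpace.single 0 1 : EuclideanSpace ℝ (Fin 3))
            ((ℝ ∙ (EuclideanSpace.single 0 1 : EuclideanSpace ℝ (Fin 3)))ᗮ.reflection (x i))) •
            (ℝ ∙ (EuclideanSpace.single 0 1 : EuclideanSpace ℝ (Fin 3)))ᗮ.reflection (x i)) -
        2 * Δ * (∑ i, inner ℝ (EuclideanSpace.single 0 1 : EuclideanSpace ℝ (Fin 3))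
          ((ℝ ∙ (EuclideanSpace.single 0 1 : EuclideanSpace ℝ (Fin 3)))ᗮ.reflection (x i))) *
          F (fun i => (ℝ ∙ (EuclideanSpace.single 0 1 : EuclideanSpace ℝ (Fin 3)))ᗮ.reflection (x i)) =
      -(fderiv ℝ F x (fun i => ‖x i‖ ^ 2 • (EuclideanSpace.single 0 1 : EuclideanSpace ℝ (Fin 3)) -
          (2 * inner ℝ (EuclideanSpace.single 0 1 : EuclideanSpace ℝ (Fin 3)) (x i)) • x i) -
        2 * Δ * (∑ i, inner ℝ (EuclideanSpace.single 0 1 : EuclideanSpace ℝ (Fin 3)) (x i)) * F x) := by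
  set e0 : EuclideanSpace ℝ (Fin 3) := EuclideanSpace.single 0 1 with he0
  set Z : EuclideanSpace ℝ (Fin 3) ≃ₗᵢ[ℝ] EuclideanSpace ℝ (Fin 3) := (ℝ ∙ e0)ᗮ.reflection with hZ
  set 𝓔 : EuclideanSpace ℝ (Fin 3) → (Fin n → EuclideanSpace ℝ (Fin 3)) → ℝ := fun b' y =>
    fderiv ℝ F y (fun i => ‖y i‖ ^ 2 • b' - (2 * inner ℝ b' (y i)) • y i) - 2 * Δ * (∑ i, inner ℝ b' (y i)) * F y with h𝓔
  have hZe0 : Z e0 = -e0 := by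
    rw [hZ, Submodule.reflection_orthogonal_apply, Submodule.reflection_mem_subspace_eq_self (Submodule.mem_span_singleton_self e0)]
  -- Z1 with `R = Z`
  have h1 : 𝓔 (Z e0) (fun i => Z (x i)) = 𝓔 e0 x := by
    have h := stub_defect_rotate n F Δ Z (fun y => hrot Z y) e0 x
    simpa only [h𝓔, LinearIsometryEquiv.norm_map, LinearIsometryEquiv.inner_map_map] using h
  have h2 : 𝓔 (-e0) (fun i => Z (x i)) = -𝓔 e0 (fun i => Z (x i)) := by
    simp only [h𝓔]
    exact defect_neg_left n F Δ e0 _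
  rw [hZe0] at h1
  have h3 : 𝓔 e0 (fun i => Z (x i)) = -𝓔 e0 x := by linarith
  simpa only [h𝓔] using h3

/-- **PARITY of the jet: at a configuration in the plane `e₀^⊥`, the Taylor jet of the `K_{e₀}` defect of an `O(3)`-invariant level is
ODD under the height reflection**: `D^kE(x₀)[ẑm₁,…,ẑm_k] = −D^kE(x₀)[m₁,…,m_k]` for every order `k` and all directions (oddness of the
defect, P1, `ẑ x₀ = x₀`).  No differentiability hypothesis. [cite: FrancescoMathieuSenechal1997, §4.1 (4.18)–(4.19)] -/
theorem jetK1_heightReflection (n : ℕ) (F : (Fin n → EuclideanSpace ℝ (Fin 3)) → ℝ) (Δ : ℝ)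
    (hrot : ∀ (R : EuclideanSpace ℝ (Fin 3) ≃ₗᵢ[ℝ] EuclideanSpace ℝ (Fin 3)) (y : Fin n → EuclideanSpace ℝ (Fin 3)),
      F (fun i => R (y i)) = F y)
    (x₀ : Fin n → EuclideanSpace ℝ (Fin 3))
    (hplane : ∀ i, inner ℝ (EuclideanSpace.single 0 1 : EuclideanSpace ℝ (Fin 3)) (x₀ i) = 0)
    (k : ℕ) (m : Fin k → Fin n → EuclideanSpace ℝ (Fin 3)) :
    iteratedFDeriv ℝ k (fun x : Fin n → EuclideanSpace ℝ (Fin 3) =>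
        fderiv ℝ F x (fun i => ‖x i‖ ^ 2 • (EuclideanSpace.single 0 1 : EuclideanSpace ℝ (Fin 3)) -
          (2 * inner ℝ (EuclideanSpace.single 0 1 : EuclideanSpace ℝ (Fin 3)) (x i)) • x i) -
        2 * Δ * (∑ i, inner ℝ (EuclideanSpace.single 0 1 : EuclideanSpace ℝ (Fin 3)) (x i)) * F x) x₀
        (fun j i => (ℝ ∙ (EuclideanSpace.single 0 1 : EuclideanSpace ℝ (Fin 3)))ᗮ.reflection (m j i)) =
      -iteratedFDeriv ℝ k (fun x : Fin n → EuclideanSpace ℝ (Fin 3) =>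
        fderiv ℝ F x (fun i => ‖x i‖ ^ 2 • (EuclideanSpace.single 0 1 : EuclideanSpace ℝ (Fin 3)) -
          (2 * inner ℝ (EuclideanSpace.single 0 1 : EuclideanSpace ℝ (Fin 3)) (x i)) • x i) -
        2 * Δ * (∑ i, inner ℝ (EuclideanSpace.single 0 1 : EuclideanSpace ℝ (Fin 3)) (x i)) * F x) x₀ m := by
  set e0 : EuclideanSpace ℝ (Fin 3) := EuclideanSpace.single 0 1 with he0
  set D : (Fin n → EuclideanSpace ℝ (Fin 3)) → ℝ := fun x =>
    fderiv ℝ F x (fun i => ‖x i‖ ^ 2 • e0 - (2 * inner ℝ e0 (x i)) • x i) - 2 * Δ * (∑ i, inner ℝ e0 (x i)) * F x with hD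
  set Z : EuclideanSpace ℝ (Fin 3) ≃ₗᵢ[ℝ] EuclideanSpace ℝ (Fin 3) := (ℝ ∙ e0)ᗮ.reflection with hZ
  -- the diagonal height reflection as a continuous linear equivalence of the configuration space
  set g : (Fin n → EuclideanSpace ℝ (Fin 3)) ≃L[ℝ] (Fin n → EuclideanSpace ℝ (Fin 3)) :=
    ContinuousLinearEquiv.piCongrRight fun _ => Z.toContinuousLinearEquiv with hg
  have hgapply : ∀ y : Fin n → EuclideanSpace ℝ (Fin 3), g y = fun i => Z (y i) := fun y => rfl
  have hgx₀ : g x₀ = x₀ := by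
    rw [hgapply]
    funext i
    exact Submodule.reflection_mem_subspace_eq_self ((Submodule.mem_orthogonal_singleton_iff_inner_right).2 (hplane i))
  have hodd : D ∘ g = -D := funext fun y => by
    have h := defectK1_heightReflection n F Δ hrot y
    simpa only [hD, comp_apply, hgapply, Pi.neg_apply] using h
  have h := stub_iteratedFDeriv_comp_continuousLinearEquiv n k D g x₀ m
  rw [hodd, iteratedFDeriv_neg_apply, hgx₀, neg_apply] at h
  have hgm : (fun j => g (m j)) = fun j i => Z (m j i) := funext fun j => hgapply (m j)
  rw [hgm] at h
  linarith

/-- **Sign selection rule.**  If each direction `mⱼ` is an eigenvector of the height reflection, `ẑ mⱼ = εⱼ mⱼ`, and `∏ εⱼ = 1` (an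
EVEN number of `εⱼ = −1`), then `D^kE(x₀)[m₁,…,m_k] = 0` (parity + multilinearity). [cite: FrancescoMathieuSenechal1997, §4.1 (4.18)–(4.19)] -/
theorem jetK1_eq_zero_of_reflection_signs (n : ℕ) (F : (Fin n → EuclideanSpace ℝ (Fin 3)) → ℝ) (Δ : ℝ)
    (hrot : ∀ (R : EuclideanSpace ℝ (Fin 3) ≃ₗᵢ[ℝ] EuclideanSpace ℝ (Fin 3)) (y : Fin n → EuclideanSpace ℝ (Fin 3)),
      F (fun i => R (y i)) = F y)
    (x₀ : Fin n → EuclideanSpace ℝ (Fin 3))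
    (hplane : ∀ i, inner ℝ (EuclideanSpace.single 0 1 : EuclideanSpace ℝ (Fin 3)) (x₀ i) = 0)
    (k : ℕ) (m : Fin k → Fin n → EuclideanSpace ℝ (Fin 3)) (ε : Fin k → ℝ)
    (hm : ∀ j, (fun i => (ℝ ∙ (EuclideanSpace.single 0 1 : EuclideanSpace ℝ (Fin 3)))ᗮ.reflection (m j i)) = ε j • m j)
    (hε : ∏ j, ε j = 1) :
    iteratedFDeriv ℝ k (fun x : Fin n → EuclideanSpace ℝ (Fin 3) =>
        fderiv ℝ F x (fun i => ‖x i‖ ^ 2 • (EuclideanSpace.single 0 1 : EuclideanSpace ℝ (Fin 3)) -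
          (2 * inner ℝ (EuclideanSpace.single 0 1 : EuclideanSpace ℝ (Fin 3)) (x i)) • x i) -
        2 * Δ * (∑ i, inner ℝ (EuclideanSpace.single 0 1 : EuclideanSpace ℝ (Fin 3)) (x i)) * F x) x₀ m = 0 := by
  have h := jetK1_heightReflection n F Δ hrot x₀ hplane k m
  have hm' : (fun j i => (ℝ ∙ (EuclideanSpace.single 0 1 : EuclideanSpace ℝ (Fin 3)))ᗮ.reflection (m j i)) =
      fun j => ε j • m j := funext fun j => hm j
  rw [hm', ContinuousMultilinearMap.map_smul_univ, hε, one_smul] at h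
  linarith

/-- **Standard-basis form of the parity rule.**  The standard basis vector `Pi.single i (EuclideanSpace.single a 1)` of `(ℝ³)ⁿ` is
reversed by the height reflection if `a = 0` (vertical) and fixed otherwise (horizontal); hence at a configuration in `e₀^⊥` every Taylor
coefficient `∂ᵏE/∂x_{i₁a₁}⋯∂x_{i_ka_k}(x₀)` with an EVEN number of vertical slots `aⱼ = 0` vanishes, for every `O(3)`-invariant level.
[cite: FrancescoMathieuSenechal1997, §4.1 (4.18)–(4.19)] -/
theorem jetK1_basis_eq_zero_of_even_vertical (n : ℕ) (F : (Fin n → EuclideanSpace ℝ (Fin 3)) → ℝ) (Δ : ℝ)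
    (hrot : ∀ (R : EuclideanSpace ℝ (Fin 3) ≃ₗᵢ[ℝ] EuclideanSpace ℝ (Fin 3)) (y : Fin n → EuclideanSpace ℝ (Fin 3)),
      F (fun i => R (y i)) = F y)
    (x₀ : Fin n → EuclideanSpace ℝ (Fin 3))
    (hplane : ∀ i, inner ℝ (EuclideanSpace.single 0 1 : EuclideanSpace ℝ (Fin 3)) (x₀ i) = 0)
    (k : ℕ) (idx : Fin k → Fin n × Fin 3)
    (heven : Even (Finset.univ.filter fun j => (idx j).2 = 0).card) :
    iteratedFDeriv ℝ k (fun x : Fin n → EuclideanSpace ℝ (Fin 3) =>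
        fderiv ℝ F x (fun i => ‖x i‖ ^ 2 • (EuclideanSpace.single 0 1 : EuclideanSpace ℝ (Fin 3)) -
          (2 * inner ℝ (EuclideanSpace.single 0 1 : EuclideanSpace ℝ (Fin 3)) (x i)) • x i) -
        2 * Δ * (∑ i, inner ℝ (EuclideanSpace.single 0 1 : EuclideanSpace ℝ (Fin 3)) (x i)) * F x) x₀
        (fun j => Pi.single (idx j).1 (EuclideanSpace.single (idx j).2 (1:ℝ))) = 0 := by
  set e0 : EuclideanSpace ℝ (Fin 3) := EuclideanSpace.single 0 1 with he0
  set Z : EuclideanSpace ℝ (Fin 3) ≃ₗᵢ[ℝ] EuclideanSpace ℝ (Fin 3) := (ℝ ∙ e0)ᗮ.reflection with hZ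
  -- the action of `Z` on the basis vectors of `ℝ³`
  have hZsingle : ∀ a : Fin 3, Z (EuclideanSpace.single a 1) =
      (if a = 0 then (-1:ℝ) else 1) • EuclideanSpace.single a 1 := fun a => by
    by_cases ha : a = 0
    · subst ha
      rw [if_pos rfl, neg_one_smul, hZ, Submodule.reflection_orthogonal_apply,
        Submodule.reflection_mem_subspace_eq_self (Submodule.mem_span_singleton_self e0)]
    · rw [if_neg ha, one_smul, hZ]
      apply Submodule.reflection_mem_subspace_eq_self
      rw [Submodule.mem_orthogonal_singleton_iff_inner_right, he0, EuclideanSpace.inner_single_left]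
      simp [ha]
  refine jetK1_eq_zero_of_reflection_signs n F Δ hrot x₀ hplane k _ (fun j => if (idx j).2 = 0 then (-1:ℝ) else 1)
    (fun j => ?_) ?_
  · funext i
    by_cases hi : i = (idx j).1
    · subst hi
      simp only [Pi.smul_apply, Pi.single_eq_same]
      exact hZsingle _
    · simp only [Pi.smul_apply, Pi.single_eq_of_ne hi, map_zero, smul_zero]
  · rw [Finset.prod_ite, Finset.prod_const, Finset.prod_const_one, mul_one]
    exact heven.neg_one_pow

/-- **The order-`k` jet vanishes as soon as its standard-basis coefficients with an ODD number of vertical slots vanish** (at a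
configuration in `e₀^⊥`, for an `O(3)`-invariant level): the even ones vanish by parity, and a multilinear form is determined by its
values on basis tuples (P2). [cite: FrancescoMathieuSenechal1997, §4.1 (4.18)–(4.19)] -/
theorem jetK1_eq_zero_of_odd_vertical (n : ℕ) (F : (Fin n → EuclideanSpace ℝ (Fin 3)) → ℝ) (Δ : ℝ)
    (hrot : ∀ (R : EuclideanSpace ℝ (Fin 3) ≃ₗᵢ[ℝ] EuclideanSpace ℝ (Fin 3)) (y : Fin n → EuclideanSpace ℝ (Fin 3)),
      F (fun i => R (y i)) = F y)
    (x₀ : Fin n → EuclideanSpace ℝ (Fin 3))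
    (hplane : ∀ i, inner ℝ (EuclideanSpace.single 0 1 : EuclideanSpace ℝ (Fin 3)) (x₀ i) = 0) (k : ℕ)
    (hodd : ∀ idx : Fin k → Fin n × Fin 3, Odd (Finset.univ.filter fun j => (idx j).2 = 0).card →
      iteratedFDeriv ℝ k (fun x : Fin n → EuclideanSpace ℝ (Fin 3) =>
        fderiv ℝ F x (fun i => ‖x i‖ ^ 2 • (EuclideanSpace.single 0 1 : EuclideanSpace ℝ (Fin 3)) -
          (2 * inner ℝ (EuclideanSpace.single 0 1 : EuclideanSpace ℝ (Fin 3)) (x i)) • x i) -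
        2 * Δ * (∑ i, inner ℝ (EuclideanSpace.single 0 1 : EuclideanSpace ℝ (Fin 3)) (x i)) * F x) x₀
        (fun j => Pi.single (idx j).1 (EuclideanSpace.single (idx j).2 (1:ℝ))) = 0) :
    iteratedFDeriv ℝ k (fun x : Fin n → EuclideanSpace ℝ (Fin 3) =>
        fderiv ℝ F x (fun i => ‖x i‖ ^ 2 • (EuclideanSpace.single 0 1 : EuclideanSpace ℝ (Fin 3)) -
          (2 * inner ℝ (EuclideanSpace.single 0 1 : EuclideanSpace ℝ (Fin 3)) (x i)) • x i) -
        2 * Δ * (∑ i, inner ℝ (EuclideanSpace.single 0 1 : EuclideanSpace ℝ (Fin 3)) (x i)) * F x) x₀ = 0 := by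
  refine stub_multilinear_eq_zero_of_basis n k _ fun idx => ?_
  rcases Nat.even_or_odd (Finset.univ.filter fun j => (idx j).2 = 0).card with he | ho
  · exact jetK1_basis_eq_zero_of_even_vertical n F Δ hrot x₀ hplane k idx he
  · exact hodd idx ho

end Summit.CriticalPhenomena.Ising3DConformalLimit.MoebiusLimitExistsSketchV22

namespace Summit.CriticalPhenomena.Ising3DConformalLimit.MoebiusLimitExistsSketchV24

open Summit.CriticalPhenomena.Ising3DConformalLimit.MoebiusLimitExistsSketchV16
  (stub_defect_rotate stub_defect_perm stub_fderiv_apply_eq_zero_of_eventually_line)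
open Summit.CriticalPhenomena.Ising3DConformalLimit.MoebiusLimitExistsSketchV22 (stub_iteratedFDeriv_comp_continuousLinearEquiv)
open Summit.CriticalPhenomena.Ising3DConformalLimit.MoebiusLimitExistsLocalWard (analyticOnNhd_limit analyticOnNhd_defect)
open Summit.CriticalPhenomena.Ising3DConformalLimit.MoebiusLimitExistsDefectSymmetry (limit_defect_translate limit_defect_dilate)
open Summit.CriticalPhenomena.Ising3DConformalLimit.Cruxes.InversionUpgradeNormalised.FreeEndpointGaussianClosure
  (isPermutationSymmetric_of_limit)

/-! ## v24 §K-stubs. Registered pure stubs K0, E1, Z3' (wave 3 of lead c20) -/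

/-! K0 `stub_hessian_apply_eq_zero_of_fderiv_identity` LANDED p167500 (`Theorems/PlantedPinningMoebiusLimitExistsHessianKernel.lean`), E1
`stub_fderiv_self_of_homogeneous_at` LANDED p167468 (`…EulerAt.lean`), Z3' `stub_fderiv_axialRotationGenerator` LANDED p167615
(`…AxialRotationGenerator.lean`, reusable `exp_smul_clm_apply_eq_self_of_apply_eq_zero`) — wave 3 of lead c20 (three stub-workers, one
message, all `stub-landed` within 5 min), in this namespace, imported above. -/

/-! ## K (pure). Jet invariance under the stabiliser, and the `K_{e₀}` defect is invariant under isometries fixing `e₀` -/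

/-- **The `K_{e₀}` defect of an `O(3)`-invariant level is INVARIANT under the diagonal action of every linear isometry fixing `e₀`**
(Z1 with `R e₀ = e₀`). [cite: FrancescoMathieuSenechal1997, §4.1 (4.18)–(4.19)] -/
theorem defectK1_axial_invariant (n : ℕ) (F : (Fin n → EuclideanSpace ℝ (Fin 3)) → ℝ) (Δ : ℝ)
    (hrot : ∀ (R : EuclideanSpace ℝ (Fin 3) ≃ₗᵢ[ℝ] EuclideanSpace ℝ (Fin 3)) (y : Fin n → EuclideanSpace ℝ (Fin 3)),
      F (fun i => R (y i)) = F y)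
    (R : EuclideanSpace ℝ (Fin 3) ≃ₗᵢ[ℝ] EuclideanSpace ℝ (Fin 3))
    (hR0 : R (EuclideanSpace.single 0 1) = EuclideanSpace.single 0 1) (x : Fin n → EuclideanSpace ℝ (Fin 3)) :
    fderiv ℝ F (fun i => R (x i))
        (fun i => ‖R (x i)‖ ^ 2 • (EuclideanSpace.single 0 1 : EuclideanSpace ℝ (Fin 3)) -
          (2 * inner ℝ (EuclideanSpace.single 0 1 : EuclideanSpace ℝ (Fin 3)) (R (x i))) • R (x i)) -
        2 * Δ * (∑ i, inner ℝ (EuclideanSpace.single 0 1 : EuclideanSpace ℝ (Fin 3)) (R (x i))) * F (fun i => R (x i)) =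
      fderiv ℝ F x (fun i => ‖x i‖ ^ 2 • (EuclideanSpace.single 0 1 : EuclideanSpace ℝ (Fin 3)) -
          (2 * inner ℝ (EuclideanSpace.single 0 1 : EuclideanSpace ℝ (Fin 3)) (x i)) • x i) -
        2 * Δ * (∑ i, inner ℝ (EuclideanSpace.single 0 1 : EuclideanSpace ℝ (Fin 3)) (x i)) * F x := by
  have h := stub_defect_rotate n F Δ R (fun y => hrot R y) (EuclideanSpace.single 0 1) x
  rw [hR0] at h
  exact h

/-- **Jet invariance under the stabiliser.**  If a linear isometry `R` fixing `e₀` maps `x₀` to its relabelling by `σ` (`R x₀ᵢ = x₀_{σ i}`),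
then the Taylor jet at `x₀` of the `K_{e₀}` defect of every `O(3) × S_n`-invariant level is invariant under `m ↦ (R̂m)∘σ⁻¹` in every slot
(the defect is invariant under the continuous linear equivalence `y ↦ (R̂y)∘σ⁻¹`, which fixes `x₀`; P1).  At the regular polygon this is
the dihedral `D_n`-equivariance of the jet. [cite: FrancescoMathieuSenechal1997, §4.1 (4.18)–(4.19)] -/
theorem jetK1_comp_symmetry (n : ℕ) (F : (Fin n → EuclideanSpace ℝ (Fin 3)) → ℝ) (Δ : ℝ)
    (hrot : ∀ (R : EuclideanSpace ℝ (Fin 3) ≃ₗᵢ[ℝ] EuclideanSpace ℝ (Fin 3)) (y : Fin n → EuclideanSpace ℝ (Fin 3)),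
      F (fun i => R (y i)) = F y)
    (hperm : ∀ (σ : Equiv.Perm (Fin n)) (y : Fin n → EuclideanSpace ℝ (Fin 3)), F (y ∘ σ) = F y)
    (R : EuclideanSpace ℝ (Fin 3) ≃ₗᵢ[ℝ] EuclideanSpace ℝ (Fin 3))
    (hR0 : R (EuclideanSpace.single 0 1) = EuclideanSpace.single 0 1) (σ : Equiv.Perm (Fin n))
    (x₀ : Fin n → EuclideanSpace ℝ (Fin 3)) (hRx : ∀ i, R (x₀ i) = x₀ (σ i))
    (k : ℕ) (m : Fin k → Fin n → EuclideanSpace ℝ (Fin 3)) :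
    iteratedFDeriv ℝ k (fun x : Fin n → EuclideanSpace ℝ (Fin 3) =>
        fderiv ℝ F x (fun i => ‖x i‖ ^ 2 • (EuclideanSpace.single 0 1 : EuclideanSpace ℝ (Fin 3)) -
          (2 * inner ℝ (EuclideanSpace.single 0 1 : EuclideanSpace ℝ (Fin 3)) (x i)) • x i) -
        2 * Δ * (∑ i, inner ℝ (EuclideanSpace.single 0 1 : EuclideanSpace ℝ (Fin 3)) (x i)) * F x) x₀
        (fun j i => R (m j (σ.symm i))) =
      iteratedFDeriv ℝ k (fun x : Fin n → EuclideanSpace ℝ (Fin 3) =>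
        fderiv ℝ F x (fun i => ‖x i‖ ^ 2 • (EuclideanSpace.single 0 1 : EuclideanSpace ℝ (Fin 3)) -
          (2 * inner ℝ (EuclideanSpace.single 0 1 : EuclideanSpace ℝ (Fin 3)) (x i)) • x i) -
        2 * Δ * (∑ i, inner ℝ (EuclideanSpace.single 0 1 : EuclideanSpace ℝ (Fin 3)) (x i)) * F x) x₀ m := by
  set e0 : EuclideanSpace ℝ (Fin 3) := EuclideanSpace.single 0 1 with he0
  set D : (Fin n → EuclideanSpace ℝ (Fin 3)) → ℝ := fun x =>
    fderiv ℝ F x (fun i => ‖x i‖ ^ 2 • e0 - (2 * inner ℝ e0 (x i)) • x i) - 2 * Δ * (∑ i, inner ℝ e0 (x i)) * F x with hD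
  -- the symmetry as a continuous linear equivalence `g y = (R̂ y) ∘ σ⁻¹`
  set g : (Fin n → EuclideanSpace ℝ (Fin 3)) ≃L[ℝ] (Fin n → EuclideanSpace ℝ (Fin 3)) :=
    (ContinuousLinearEquiv.piCongrRight fun _ : Fin n => R.toContinuousLinearEquiv).trans
      (LinearEquiv.funCongrLeft ℝ (EuclideanSpace ℝ (Fin 3)) σ.symm).toContinuousLinearEquiv with hg
  have hgapply : ∀ y : Fin n → EuclideanSpace ℝ (Fin 3), g y = fun i => R (y (σ.symm i)) := fun y => rfl
  have hgx₀ : g x₀ = x₀ := by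
    rw [hgapply]; funext i; rw [hRx, Equiv.apply_symm_apply]
  -- `D ∘ g = D`: Z1 (isometry fixing `e₀`) then Z2 (relabelling)
  have hinv : D ∘ g = D := funext fun y => by
    have h1 := defectK1_axial_invariant n F Δ hrot R hR0 (y ∘ σ.symm)
    have h2 := stub_defect_perm n F Δ σ.symm (fun z => hperm σ.symm z) e0 y
    simp only [comp_apply, hgapply]
    simp only [hD, comp_apply] at h1 h2 ⊢
    rw [h1, h2]
  have h := stub_iteratedFDeriv_comp_continuousLinearEquiv n k D g x₀ m
  rw [hinv, hgx₀] at h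
  have hgm : (fun j => g (m j)) = fun j i => R (m j (σ.symm i)) := funext fun j => hgapply (m j)
  rw [hgm] at h
  exact h.symm

/-! ## K (Ising₃ limits). First-order symmetry identities of the defect near a configuration, and the order-2 KERNELS -/

section Limit

variable {ρ : ℝ → ℝ} {Δ : ℝ} {S : CorrFamily 3}

/-- **Translation: `DD_n(y)[ĉ] = 0`** at every non-coincident `y` (the defect is translation invariant on `NonCoincident`,
`limit_defect_translate`; Y3 on `z ↦ D_n z − D_n y`). [cite: FrancescoMathieuSenechal1997, §4.1 (4.19)] -/
theorem limit_fderiv_defectK1_const_eq_zero (hρ : ∀ δ ∈ Set.Ioc (0:ℝ) 1, 0 < ρ δ)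
    (hlim : HasPointwiseScalingLimit (criticalCorr 3) ρ S)
    (hnorm : ∀ n z, z ∉ NonCoincident 3 n → S n z = 0) (hnd : IsNondegenerateTwoPoint S)
    (heuc : IsEuclideanInvariant S) (hsc : IsScaleCovariant Δ S)
    {n : ℕ} {y : Fin n → EuclideanSpace ℝ (Fin 3)} (hy : y ∈ NonCoincident 3 n) (c : EuclideanSpace ℝ (Fin 3)) :
    fderiv ℝ (fun x : Fin n → EuclideanSpace ℝ (Fin 3) =>
        fderiv ℝ (S n) x (fun i => ‖x i‖ ^ 2 • (EuclideanSpace.single 0 1 : EuclideanSpace ℝ (Fin 3)) -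
          (2 * inner ℝ (EuclideanSpace.single 0 1 : EuclideanSpace ℝ (Fin 3)) (x i)) • x i) -
        2 * Δ * (∑ i, inner ℝ (EuclideanSpace.single 0 1 : EuclideanSpace ℝ (Fin 3)) (x i)) * S n x) y (fun _ => c) = 0 := by
  set e0 : EuclideanSpace ℝ (Fin 3) := EuclideanSpace.single 0 1 with he0
  set D : (Fin n → EuclideanSpace ℝ (Fin 3)) → ℝ := fun x =>
    fderiv ℝ (S n) x (fun i => ‖x i‖ ^ 2 • e0 - (2 * inner ℝ e0 (x i)) • x i) - 2 * Δ * (∑ i, inner ℝ e0 (x i)) * S n x with hD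
  have hDdiff : DifferentiableAt ℝ D y :=
    (analyticOnNhd_defect (analyticOnNhd_limit hρ hlim hnorm hnd heuc hsc n) Δ e0 y hy).differentiableAt
  -- `D (y + t ĉ) = D y` for every `t`
  have hconst : ∀ t : ℝ, D (y + t • fun _ => c) = D y := fun t => by
    have h := limit_defect_translate hρ hlim hnorm hnd heuc hsc hy e0 (t • c)
    have hcfg : (y + t • fun _ : Fin n => c) = fun i => y i + t • c := funext fun i => by simp
    rw [hcfg]
    simpa only [hD] using h
  have h0 : fderiv ℝ (fun z => D z - D y) y (fun _ => c) = 0 :=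
    stub_fderiv_apply_eq_zero_of_eventually_line n (fun z => D z - D y) y (fun _ => c) (hDdiff.sub_const _)
      (Filter.Eventually.of_forall fun t => by simp only [hconst t, sub_self])
  rwa [fderiv_sub_const] at h0

/-- **Dilation: the Euler identity of the defect, `DD_n(y)[y] = (1 − nΔ) D_n(y)`** at every non-coincident `y` (`limit_defect_dilate` + E1).
[cite: FrancescoMathieuSenechal1997, §4.1 (4.19)] -/
theorem limit_fderiv_defectK1_self (hρ : ∀ δ ∈ Set.Ioc (0:ℝ) 1, 0 < ρ δ)
    (hlim : HasPointwiseScalingLimit (criticalCorr 3) ρ S)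
    (hnorm : ∀ n z, z ∉ NonCoincident 3 n → S n z = 0) (hnd : IsNondegenerateTwoPoint S)
    (heuc : IsEuclideanInvariant S) (hsc : IsScaleCovariant Δ S)
    {n : ℕ} {y : Fin n → EuclideanSpace ℝ (Fin 3)} (hy : y ∈ NonCoincident 3 n) :
    fderiv ℝ (fun x : Fin n → EuclideanSpace ℝ (Fin 3) =>
        fderiv ℝ (S n) x (fun i => ‖x i‖ ^ 2 • (EuclideanSpace.single 0 1 : EuclideanSpace ℝ (Fin 3)) -
          (2 * inner ℝ (EuclideanSpace.single 0 1 : EuclideanSpace ℝ (Fin 3)) (x i)) • x i) -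
        2 * Δ * (∑ i, inner ℝ (EuclideanSpace.single 0 1 : EuclideanSpace ℝ (Fin 3)) (x i)) * S n x) y y =
      (1 - (n : ℝ) * Δ) *
        (fderiv ℝ (S n) y (fun i => ‖y i‖ ^ 2 • (EuclideanSpace.single 0 1 : EuclideanSpace ℝ (Fin 3)) -
          (2 * inner ℝ (EuclideanSpace.single 0 1 : EuclideanSpace ℝ (Fin 3)) (y i)) • y i) -
        2 * Δ * (∑ i, inner ℝ (EuclideanSpace.single 0 1 : EuclideanSpace ℝ (Fin 3)) (y i)) * S n y) := by
  set e0 : EuclideanSpace ℝ (Fin 3) := EuclideanSpace.single 0 1 with he0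
  set D : (Fin n → EuclideanSpace ℝ (Fin 3)) → ℝ := fun x =>
    fderiv ℝ (S n) x (fun i => ‖x i‖ ^ 2 • e0 - (2 * inner ℝ e0 (x i)) • x i) - 2 * Δ * (∑ i, inner ℝ e0 (x i)) * S n x with hD
  have hDdiff : DifferentiableAt ℝ D y :=
    (analyticOnNhd_defect (analyticOnNhd_limit hρ hlim hnorm hnd heuc hsc n) Δ e0 y hy).differentiableAt
  refine stub_fderiv_self_of_homogeneous_at n D (1 - (n : ℝ) * Δ) y hDdiff fun t ht => ?_
  have h := limit_defect_dilate hρ hlim hnorm hnd heuc hsc hy e0 ht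
  have hcfg : t • y = fun i => t • y i := rfl
  rw [hcfg]
  simpa only [hD] using h

/-- **Axial rotation: `DD_n(y)[(⟪e₂,yᵢ⟫e₁ − ⟪e₁,yᵢ⟫e₂)ᵢ] = 0`** at every non-coincident `y` (the defect is invariant under the isometries
fixing `e₀`, `defectK1_axial_invariant`; Z3'). [cite: FrancescoMathieuSenechal1997, §4.1 (4.19)] -/
theorem limit_fderiv_defectK1_axialRotation_eq_zero (hρ : ∀ δ ∈ Set.Ioc (0:ℝ) 1, 0 < ρ δ)
    (hlim : HasPointwiseScalingLimit (criticalCorr 3) ρ S)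
    (hnorm : ∀ n z, z ∉ NonCoincident 3 n → S n z = 0) (hnd : IsNondegenerateTwoPoint S)
    (heuc : IsEuclideanInvariant S) (hsc : IsScaleCovariant Δ S)
    {n : ℕ} {y : Fin n → EuclideanSpace ℝ (Fin 3)} (hy : y ∈ NonCoincident 3 n) :
    fderiv ℝ (fun x : Fin n → EuclideanSpace ℝ (Fin 3) =>
        fderiv ℝ (S n) x (fun i => ‖x i‖ ^ 2 • (EuclideanSpace.single 0 1 : EuclideanSpace ℝ (Fin 3)) -
          (2 * inner ℝ (EuclideanSpace.single 0 1 : EuclideanSpace ℝ (Fin 3)) (x i)) • x i) -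
        2 * Δ * (∑ i, inner ℝ (EuclideanSpace.single 0 1 : EuclideanSpace ℝ (Fin 3)) (x i)) * S n x) y
      (fun i => inner ℝ (EuclideanSpace.single 2 1 : EuclideanSpace ℝ (Fin 3)) (y i) •
          (EuclideanSpace.single 1 1 : EuclideanSpace ℝ (Fin 3)) -
        inner ℝ (EuclideanSpace.single 1 1 : EuclideanSpace ℝ (Fin 3)) (y i) •
          (EuclideanSpace.single 2 1 : EuclideanSpace ℝ (Fin 3))) = 0 := by
  set e0 : EuclideanSpace ℝ (Fin 3) := EuclideanSpace.single 0 1 with he0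
  set D : (Fin n → EuclideanSpace ℝ (Fin 3)) → ℝ := fun x =>
    fderiv ℝ (S n) x (fun i => ‖x i‖ ^ 2 • e0 - (2 * inner ℝ e0 (x i)) • x i) - 2 * Δ * (∑ i, inner ℝ e0 (x i)) * S n x with hD
  have hDdiff : DifferentiableAt ℝ D y :=
    (analyticOnNhd_defect (analyticOnNhd_limit hρ hlim hnorm hnd heuc hsc n) Δ e0 y hy).differentiableAt
  refine stub_fderiv_axialRotationGenerator n D y hDdiff fun R hR0 z => ?_
  have h := defectK1_axial_invariant n (S n) Δ (fun R' w => heuc.2 n R' w) R hR0 z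
  simpa only [hD] using h

/-- **The order-2 KERNELS of the `K_{e₀}`-defect jet at a critical configuration.**  For an Ising₃ limit as above, at every
non-coincident `x₀` where `DD_n(x₀) = 0` (e.g. the regular horizontal polygon, `…TransitiveJet.lean`), the Hessian of `D_n` kills, in
either slot, every constant (translation) direction `ĉ`, the dilation direction `x₀`, and the axial-rotation direction
`(⟪e₂,x₀ᵢ⟫e₁ − ⟪e₁,x₀ᵢ⟫e₂)ᵢ` (K0 fed by the three first-order identities; `[P,K]`, `[D,K]`, `[M,K]` read on the jet).
[cite: FrancescoMathieuSenechal1997, §4.1 (4.19)] -/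
theorem limit_hessian_defectK1_kernels (hρ : ∀ δ ∈ Set.Ioc (0:ℝ) 1, 0 < ρ δ)
    (hlim : HasPointwiseScalingLimit (criticalCorr 3) ρ S)
    (hnorm : ∀ n z, z ∉ NonCoincident 3 n → S n z = 0) (hnd : IsNondegenerateTwoPoint S)
    (heuc : IsEuclideanInvariant S) (hsc : IsScaleCovariant Δ S)
    {n : ℕ} {x₀ : Fin n → EuclideanSpace ℝ (Fin 3)} (hx₀ : x₀ ∈ NonCoincident 3 n)
    (hD1 : fderiv ℝ (fun x : Fin n → EuclideanSpace ℝ (Fin 3) =>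
        fderiv ℝ (S n) x (fun i => ‖x i‖ ^ 2 • (EuclideanSpace.single 0 1 : EuclideanSpace ℝ (Fin 3)) -
          (2 * inner ℝ (EuclideanSpace.single 0 1 : EuclideanSpace ℝ (Fin 3)) (x i)) • x i) -
        2 * Δ * (∑ i, inner ℝ (EuclideanSpace.single 0 1 : EuclideanSpace ℝ (Fin 3)) (x i)) * S n x) x₀ = 0)
    (m : Fin n → EuclideanSpace ℝ (Fin 3)) (c : EuclideanSpace ℝ (Fin 3)) :
    (iteratedFDeriv ℝ 2 (fun x : Fin n → EuclideanSpace ℝ (Fin 3) =>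
        fderiv ℝ (S n) x (fun i => ‖x i‖ ^ 2 • (EuclideanSpace.single 0 1 : EuclideanSpace ℝ (Fin 3)) -
          (2 * inner ℝ (EuclideanSpace.single 0 1 : EuclideanSpace ℝ (Fin 3)) (x i)) • x i) -
        2 * Δ * (∑ i, inner ℝ (EuclideanSpace.single 0 1 : EuclideanSpace ℝ (Fin 3)) (x i)) * S n x) x₀ ![m, fun _ => c] = 0 ∧
     iteratedFDeriv ℝ 2 (fun x : Fin n → EuclideanSpace ℝ (Fin 3) =>
        fderiv ℝ (S n) x (fun i => ‖x i‖ ^ 2 • (EuclideanSpace.single 0 1 : EuclideanSpace ℝ (Fin 3)) -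
          (2 * inner ℝ (EuclideanSpace.single 0 1 : EuclideanSpace ℝ (Fin 3)) (x i)) • x i) -
        2 * Δ * (∑ i, inner ℝ (EuclideanSpace.single 0 1 : EuclideanSpace ℝ (Fin 3)) (x i)) * S n x) x₀ ![fun _ => c, m] = 0) ∧
    (iteratedFDeriv ℝ 2 (fun x : Fin n → EuclideanSpace ℝ (Fin 3) =>
        fderiv ℝ (S n) x (fun i => ‖x i‖ ^ 2 • (EuclideanSpace.single 0 1 : EuclideanSpace ℝ (Fin 3)) -
          (2 * inner ℝ (EuclideanSpace.single 0 1 : EuclideanSpace ℝ (Fin 3)) (x i)) • x i) -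
        2 * Δ * (∑ i, inner ℝ (EuclideanSpace.single 0 1 : EuclideanSpace ℝ (Fin 3)) (x i)) * S n x) x₀ ![m, x₀] = 0 ∧
     iteratedFDeriv ℝ 2 (fun x : Fin n → EuclideanSpace ℝ (Fin 3) =>
        fderiv ℝ (S n) x (fun i => ‖x i‖ ^ 2 • (EuclideanSpace.single 0 1 : EuclideanSpace ℝ (Fin 3)) -
          (2 * inner ℝ (EuclideanSpace.single 0 1 : EuclideanSpace ℝ (Fin 3)) (x i)) • x i) -
        2 * Δ * (∑ i, inner ℝ (EuclideanSpace.single 0 1 : EuclideanSpace ℝ (Fin 3)) (x i)) * S n x) x₀ ![x₀, m] = 0) ∧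
    (iteratedFDeriv ℝ 2 (fun x : Fin n → EuclideanSpace ℝ (Fin 3) =>
        fderiv ℝ (S n) x (fun i => ‖x i‖ ^ 2 • (EuclideanSpace.single 0 1 : EuclideanSpace ℝ (Fin 3)) -
          (2 * inner ℝ (EuclideanSpace.single 0 1 : EuclideanSpace ℝ (Fin 3)) (x i)) • x i) -
        2 * Δ * (∑ i, inner ℝ (EuclideanSpace.single 0 1 : EuclideanSpace ℝ (Fin 3)) (x i)) * S n x) x₀
        ![m, fun i => inner ℝ (EuclideanSpace.single 2 1 : EuclideanSpace ℝ (Fin 3)) (x₀ i) •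
            (EuclideanSpace.single 1 1 : EuclideanSpace ℝ (Fin 3)) -
          inner ℝ (EuclideanSpace.single 1 1 : EuclideanSpace ℝ (Fin 3)) (x₀ i) •
            (EuclideanSpace.single 2 1 : EuclideanSpace ℝ (Fin 3))] = 0 ∧
     iteratedFDeriv ℝ 2 (fun x : Fin n → EuclideanSpace ℝ (Fin 3) =>
        fderiv ℝ (S n) x (fun i => ‖x i‖ ^ 2 • (EuclideanSpace.single 0 1 : EuclideanSpace ℝ (Fin 3)) -
          (2 * inner ℝ (EuclideanSpace.single 0 1 : EuclideanSpace ℝ (Fin 3)) (x i)) • x i) -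
        2 * Δ * (∑ i, inner ℝ (EuclideanSpace.single 0 1 : EuclideanSpace ℝ (Fin 3)) (x i)) * S n x) x₀
        ![fun i => inner ℝ (EuclideanSpace.single 2 1 : EuclideanSpace ℝ (Fin 3)) (x₀ i) •
            (EuclideanSpace.single 1 1 : EuclideanSpace ℝ (Fin 3)) -
          inner ℝ (EuclideanSpace.single 1 1 : EuclideanSpace ℝ (Fin 3)) (x₀ i) •
            (EuclideanSpace.single 2 1 : EuclideanSpace ℝ (Fin 3)), m] = 0) := by
  set e0 : EuclideanSpace ℝ (Fin 3) := EuclideanSpace.single 0 1 with he0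
  set D : (Fin n → EuclideanSpace ℝ (Fin 3)) → ℝ := fun x =>
    fderiv ℝ (S n) x (fun i => ‖x i‖ ^ 2 • e0 - (2 * inner ℝ e0 (x i)) • x i) - 2 * Δ * (∑ i, inner ℝ e0 (x i)) * S n x with hD
  have hDan : AnalyticOnNhd ℝ D (NonCoincident 3 n) :=
    analyticOnNhd_defect (analyticOnNhd_limit hρ hlim hnorm hnd heuc hsc n) Δ e0
  have hC2 : ContDiffAt ℝ 2 D x₀ := (hDan x₀ hx₀).contDiffAt
  have hnhds : ∀ᶠ y in 𝓝 x₀, y ∈ NonCoincident 3 n := (isOpen_nonCoincident 3 n).mem_nhds hx₀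
  -- the three first-order identities near `x₀`, in the shape of K0
  -- translation: `A = 0`, field `ĉ`, `a = 0`
  set Cc : Fin n → EuclideanSpace ℝ (Fin 3) := fun _ => c with hCc
  have hT : ∀ᶠ y in 𝓝 x₀, fderiv ℝ D y ((0 : (Fin n → EuclideanSpace ℝ (Fin 3)) →L[ℝ] (Fin n → EuclideanSpace ℝ (Fin 3))) y + Cc) =
      0 * D y := by
    filter_upwards [hnhds] with y hy
    rw [zero_apply, zero_add, zero_mul]
    exact limit_fderiv_defectK1_const_eq_zero hρ hlim hnorm hnd heuc hsc hy c
  -- dilation: `A = id`, `c = 0`, `a = 1 − nΔ`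
  have hDil : ∀ᶠ y in 𝓝 x₀, fderiv ℝ D y ((ContinuousLinearMap.id ℝ (Fin n → EuclideanSpace ℝ (Fin 3))) y + 0) =
      (1 - (n : ℝ) * Δ) * D y := by
    filter_upwards [hnhds] with y hy
    rw [ContinuousLinearMap.id_apply, add_zero]
    exact limit_fderiv_defectK1_self hρ hlim hnorm hnd heuc hsc hy
  -- axial rotation: `A = M̂`, `c = 0`, `a = 0`
  set M : (Fin n → EuclideanSpace ℝ (Fin 3)) →L[ℝ] (Fin n → EuclideanSpace ℝ (Fin 3)) :=
    ContinuousLinearMap.pi fun i =>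
      ((innerSL ℝ (EuclideanSpace.single 2 1 : EuclideanSpace ℝ (Fin 3))).smulRight
            (EuclideanSpace.single 1 1 : EuclideanSpace ℝ (Fin 3)) -
          (innerSL ℝ (EuclideanSpace.single 1 1 : EuclideanSpace ℝ (Fin 3))).smulRight
            (EuclideanSpace.single 2 1 : EuclideanSpace ℝ (Fin 3))).comp
        (ContinuousLinearMap.proj i) with hM
  have hMapply : ∀ y : Fin n → EuclideanSpace ℝ (Fin 3), M y = fun i =>
      inner ℝ (EuclideanSpace.single 2 1 : EuclideanSpace ℝ (Fin 3)) (y i) • (EuclideanSpace.single 1 1 : EuclideanSpace ℝ (Fin 3)) -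
        inner ℝ (EuclideanSpace.single 1 1 : EuclideanSpace ℝ (Fin 3)) (y i) • (EuclideanSpace.single 2 1 : EuclideanSpace ℝ (Fin 3)) :=
    fun y => by
      funext i
      simp [hM, ContinuousLinearMap.smulRight_apply, innerSL_apply_apply]
  have hRot : ∀ᶠ y in 𝓝 x₀, fderiv ℝ D y (M y + 0) = 0 * D y := by
    filter_upwards [hnhds] with y hy
    rw [add_zero, zero_mul, hMapply]
    exact limit_fderiv_defectK1_axialRotation_eq_zero hρ hlim hnorm hnd heuc hsc hy
  have kT := stub_hessian_apply_eq_zero_of_fderiv_identity n D x₀ 0 Cc 0 hC2 hD1 hT m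
  have kD := stub_hessian_apply_eq_zero_of_fderiv_identity n D x₀ (ContinuousLinearMap.id ℝ _) 0 (1 - (n : ℝ) * Δ) hC2 hD1 hDil m
  have kR := stub_hessian_apply_eq_zero_of_fderiv_identity n D x₀ M 0 0 hC2 hD1 hRot m
  simp only [zero_apply, zero_add, ContinuousLinearMap.id_apply, add_zero, hMapply] at kT kD kR
  exact ⟨kT, kD, kR⟩

end Limit

end Summit.CriticalPhenomena.Ising3DConformalLimit.MoebiusLimitExistsSketchV24

namespace Summit.CriticalPhenomena.Ising3DConformalLimit.MoebiusLimitExistsSketchV26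

/-! ## v26 §R. The in-plane REFLECTION symmetry of the regular polygon (wave 4 of lead c20): completes the dihedral stabiliser `D_n`
(with N1b's rotation); by `MoebiusLimitExistsSketchV24.jetK1_comp_symmetry` every Taylor coefficient of `D_n` at `P_n` is then
`D_n`-invariant.  Exact linear algebra (evidence `hessian_count.md`): at `(n,k) = (4,2)` parity + kernels + `C_4` leave 4 of the 78
Hessian entries free, the reflection cuts them to 2 (c19's count, now on tree theorems); at `(6,2)`: 171 → 8 → 4. -/

/-! N1c `stub_regularPolygon_reflection` LANDED p168081 (`Theorems/PlantedPinningMoebiusLimitExistsRegularPolygonReflection.lean`) — wave 4 of lead c20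
(one stub-worker, `stub-landed` in 3 min), in this namespace, imported above. -/

section Limit

variable {ρ : ℝ → ℝ} {Δ : ℝ} {S : CorrFamily 3}

open Summit.CriticalPhenomena.Ising3DConformalLimit.Cruxes.InversionUpgradeNormalised.FreeEndpointGaussianClosure
  (isPermutationSymmetric_of_limit)

/-- **Reflection invariance of the jet at the regular polygon** (N1c + `jetK1_comp_symmetry` with `σ = Fin.revPerm`): together with the
rotation (`…HessianKernels.lean`) the full dihedral invariance of every Taylor coefficient of `D_n` at `P_n`. [cite: FrancescoMathieuSenechal1997, §4.1 (4.18)–(4.19)] -/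
theorem limit_jetK1_reflection_invariant_at_regularPolygon
    (hlim : HasPointwiseScalingLimit (criticalCorr 3) ρ S)
    (hnorm : ∀ n z, z ∉ NonCoincident 3 n → S n z = 0) (heuc : IsEuclideanInvariant S) (n : ℕ) :
    ∃ Z : EuclideanSpace ℝ (Fin 3) ≃ₗᵢ[ℝ] EuclideanSpace ℝ (Fin 3),
      Z (EuclideanSpace.single 0 1) = EuclideanSpace.single 0 1 ∧
      (∀ i : Fin n,
        Z (Real.cos (2 * Real.pi * ((i : ℕ) : ℝ) / (n : ℝ)) • (EuclideanSpace.single 1 1 : EuclideanSpace ℝ (Fin 3)) +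
            Real.sin (2 * Real.pi * ((i : ℕ) : ℝ) / (n : ℝ)) • (EuclideanSpace.single 2 1 : EuclideanSpace ℝ (Fin 3))) =
          Real.cos (2 * Real.pi * (((Fin.rev i : Fin n) : ℕ) : ℝ) / (n : ℝ)) •
              (EuclideanSpace.single 1 1 : EuclideanSpace ℝ (Fin 3)) +
            Real.sin (2 * Real.pi * (((Fin.rev i : Fin n) : ℕ) : ℝ) / (n : ℝ)) •
              (EuclideanSpace.single 2 1 : EuclideanSpace ℝ (Fin 3))) ∧
      ∀ (k : ℕ) (m : Fin k → Fin n → EuclideanSpace ℝ (Fin 3)),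
        iteratedFDeriv ℝ k (fun x : Fin n → EuclideanSpace ℝ (Fin 3) =>
            fderiv ℝ (S n) x (fun i => ‖x i‖ ^ 2 • (EuclideanSpace.single 0 1 : EuclideanSpace ℝ (Fin 3)) -
              (2 * inner ℝ (EuclideanSpace.single 0 1 : EuclideanSpace ℝ (Fin 3)) (x i)) • x i) -
            2 * Δ * (∑ i, inner ℝ (EuclideanSpace.single 0 1 : EuclideanSpace ℝ (Fin 3)) (x i)) * S n x)
          (fun i : Fin n => Real.cos (2 * Real.pi * ((i : ℕ) : ℝ) / (n : ℝ)) • (EuclideanSpace.single 1 1 : EuclideanSpace ℝ (Fin 3)) +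
            Real.sin (2 * Real.pi * ((i : ℕ) : ℝ) / (n : ℝ)) • (EuclideanSpace.single 2 1 : EuclideanSpace ℝ (Fin 3)))
          (fun j i => Z (m j (Fin.revPerm.symm i))) =
        iteratedFDeriv ℝ k (fun x : Fin n → EuclideanSpace ℝ (Fin 3) =>
            fderiv ℝ (S n) x (fun i => ‖x i‖ ^ 2 • (EuclideanSpace.single 0 1 : EuclideanSpace ℝ (Fin 3)) -
              (2 * inner ℝ (EuclideanSpace.single 0 1 : EuclideanSpace ℝ (Fin 3)) (x i)) • x i) -
            2 * Δ * (∑ i, inner ℝ (EuclideanSpace.single 0 1 : EuclideanSpace ℝ (Fin 3)) (x i)) * S n x)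
          (fun i : Fin n => Real.cos (2 * Real.pi * ((i : ℕ) : ℝ) / (n : ℝ)) • (EuclideanSpace.single 1 1 : EuclideanSpace ℝ (Fin 3)) +
            Real.sin (2 * Real.pi * ((i : ℕ) : ℝ) / (n : ℝ)) • (EuclideanSpace.single 2 1 : EuclideanSpace ℝ (Fin 3))) m := by
  obtain ⟨Z, hZ0, hZP⟩ := stub_regularPolygon_reflection n
  refine ⟨Z, hZ0, hZP, fun k m => ?_⟩
  have hperm := isPermutationSymmetric_of_limit hlim hnorm
  exact MoebiusLimitExistsSketchV24.jetK1_comp_symmetry n (S n) Δ (fun R' y => heuc.2 n R' y) (fun σ y => hperm n σ y) Z hZ0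
    Fin.revPerm _ (fun i => hZP i) k m

end Limit

end Summit.CriticalPhenomena.Ising3DConformalLimit.MoebiusLimitExistsSketchV26


namespace Summit.CriticalPhenomena.Ising3DConformalLimit.MoebiusLimitExistsSketchV20

open Summit.CriticalPhenomena.Ising3DConformalLimit.MoebiusLimitExistsSketchV16
  (stub_defect_rotate stub_defect_perm stub_fderiv_apply_eq_zero_of_eventually_line)
open Summit.CriticalPhenomena.Ising3DConformalLimit.MoebiusLimitExistsLocalWard (analyticOnNhd_limit analyticOnNhd_defect)
open Summit.CriticalPhenomena.Ising3DConformalLimit.MoebiusLimitExistsDefectSymmetry (limit_defect_eq_zero_of_coplanar)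
open Summit.CriticalPhenomena.Ising3DConformalLimit.Cruxes.InversionUpgradeNormalised.FreeEndpointGaussianClosure
  (isPermutationSymmetric_of_limit)

/-! ## v20 §A. The pure stubs N1a, N1b, N2, N3 are LANDED (wave 1 of lead c20, four stub-workers, one message, all `stub-landed`
within 8 min): N1a `stub_regularPolygon_mem_nonCoincident` p165159 (`Theorems/PlantedPinningMoebiusLimitExistsRegularPolygon.lean`),
N1b `stub_regularPolygon_rotation` p165192 (`…RegularPolygonRotation.lean`, with the reusable `exists_axialRotation θ`),
N2 `stub_cyclicInvariant_eq_zero` p165289 (`…CyclicAveraging.lean`), N3 `stub_fderiv_apply_eq_of_invariant` p165147 (`…InvariantDeriv.lean`) —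
all in this namespace, imported above. -/

/-! ## v20 §B. Lead assembly: symmetry transport of the defect, and ORDER-1 FREENESS BY TRANSITIVITY -/

/-- **Symmetry transport of the `K_b` defect to a neighbourhood of a symmetric configuration** (pure; Z1 + Z2).  If a linear isometry
`R` fixing the generator `b` maps the configuration `x₀` to its relabelling by `σ` (`R x₀ᵢ = x₀_{σ i}`), then for every
`O(3) × S_n`-invariant level `F` and every displacement `δ`: `E_b(F)(x₀ + δ) = E_b(F)(x₀ + (R̂δ) ∘ σ⁻¹)`. [cite: FrancescoMathieuSenechal1997, §4.1 (4.18)–(4.19)] -/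
theorem defect_symm_transport (n : ℕ) (F : (Fin n → EuclideanSpace ℝ (Fin 3)) → ℝ) (Δ : ℝ)
    (hrot : ∀ (R : EuclideanSpace ℝ (Fin 3) ≃ₗᵢ[ℝ] EuclideanSpace ℝ (Fin 3)) (y : Fin n → EuclideanSpace ℝ (Fin 3)),
      F (fun i => R (y i)) = F y)
    (hperm : ∀ (σ : Equiv.Perm (Fin n)) (y : Fin n → EuclideanSpace ℝ (Fin 3)), F (y ∘ σ) = F y)
    (R : EuclideanSpace ℝ (Fin 3) ≃ₗᵢ[ℝ] EuclideanSpace ℝ (Fin 3)) (σ : Equiv.Perm (Fin n))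
    (x₀ : Fin n → EuclideanSpace ℝ (Fin 3)) (hRx : ∀ i, R (x₀ i) = x₀ (σ i))
    (b : EuclideanSpace ℝ (Fin 3)) (hb : R b = b) (δ : Fin n → EuclideanSpace ℝ (Fin 3)) :
    fderiv ℝ F (x₀ + δ) (fun i => ‖(x₀ + δ) i‖ ^ 2 • b - (2 * inner ℝ b ((x₀ + δ) i)) • (x₀ + δ) i) -
        2 * Δ * (∑ i, inner ℝ b ((x₀ + δ) i)) * F (x₀ + δ) =
      fderiv ℝ F (x₀ + fun i => R (δ (σ.symm i)))
          (fun i => ‖(x₀ + fun i => R (δ (σ.symm i))) i‖ ^ 2 • b -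
            (2 * inner ℝ b ((x₀ + fun i => R (δ (σ.symm i))) i)) • (x₀ + fun i => R (δ (σ.symm i))) i) -
        2 * Δ * (∑ i, inner ℝ b ((x₀ + fun i => R (δ (σ.symm i))) i)) * F (x₀ + fun i => R (δ (σ.symm i))) := by
  set 𝓔 : EuclideanSpace ℝ (Fin 3) → (Fin n → EuclideanSpace ℝ (Fin 3)) → ℝ := fun b' y =>
    fderiv ℝ F y (fun i => ‖y i‖ ^ 2 • b' - (2 * inner ℝ b' (y i)) • y i) - 2 * Δ * (∑ i, inner ℝ b' (y i)) * F y with h𝓔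
  -- Z1 at the configuration `x₀ + δ`
  have h1 : 𝓔 (R b) (fun i => R ((x₀ + δ) i)) = 𝓔 b (x₀ + δ) := by
    have h := stub_defect_rotate n F Δ R (fun y => hrot R y) b (x₀ + δ)
    simpa only [h𝓔, LinearIsometryEquiv.norm_map, LinearIsometryEquiv.inner_map_map] using h
  -- the rotated configuration is the relabelled `x₀ + (R̂δ)∘σ⁻¹`
  have hcfg : (fun i => R ((x₀ + δ) i)) = (x₀ + fun i => R (δ (σ.symm i))) ∘ σ := funext fun i => by
    simp only [Function.comp_apply, Pi.add_apply, map_add, hRx i, Equiv.symm_apply_apply]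
  -- Z2
  have h2 : 𝓔 b ((x₀ + fun i => R (δ (σ.symm i))) ∘ σ) = 𝓔 b (x₀ + fun i => R (δ (σ.symm i))) := by
    have h := stub_defect_perm n F Δ σ (fun y => hperm σ y) b (x₀ + fun i => R (δ (σ.symm i)))
    simpa only [h𝓔] using h
  have h3 : 𝓔 b (x₀ + δ) = 𝓔 b (x₀ + fun i => R (δ (σ.symm i))) := by rw [← h1, hb, hcfg, h2]
  simpa only [h𝓔] using h3

section Limit

variable {ρ : ℝ → ℝ} {Δ : ℝ} {S : CorrFamily 3}

/-- **ORDER-1 FREENESS BY TRANSITIVITY.**  For every normalised non-degenerate Euclidean scale-covariant limit of `criticalCorr 3`,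
every level `n`, and every non-coincident configuration `x₀` lying in a plane perpendicular to `e₀` which some linear isometry `R`
with `R e₀ = e₀` maps to its CYCLIC relabelling (`R x₀ᵢ = x₀_{i+1}`), the Fréchet derivative of the `K_{e₀}` defect of `S n` vanishes
at `x₀`: the covector `DD(x₀)` kills the constant-height directions (free zeros II + Y3), is `T`-invariant for `T δ = (R̂δ)∘σ⁻¹`
(symmetry transport + N3), `T` is the cyclic shift on the vertical directions `(hᵢ e₀)ᵢ`, so N2 kills them; and every direction is
constant-height plus vertical.  No Ward identity is assumed. [cite: FrancescoMathieuSenechal1997, §4.3.1 (4.51)–(4.54)] -/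
theorem limit_fderiv_defectK1_eq_zero_of_cyclicSymmetry (hρ : ∀ δ ∈ Set.Ioc (0:ℝ) 1, 0 < ρ δ)
    (hlim : HasPointwiseScalingLimit (criticalCorr 3) ρ S)
    (hnorm : ∀ n z, z ∉ NonCoincident 3 n → S n z = 0) (hnd : IsNondegenerateTwoPoint S)
    (heuc : IsEuclideanInvariant S) (hsc : IsScaleCovariant Δ S)
    {n : ℕ} {x₀ : Fin n → EuclideanSpace ℝ (Fin 3)} (hx₀ : x₀ ∈ NonCoincident 3 n) (h : ℝ)
    (hplane : ∀ i, inner ℝ (EuclideanSpace.single 0 1 : EuclideanSpace ℝ (Fin 3)) (x₀ i) = h)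
    (R : EuclideanSpace ℝ (Fin 3) ≃ₗᵢ[ℝ] EuclideanSpace ℝ (Fin 3))
    (hR0 : R (EuclideanSpace.single 0 1) = EuclideanSpace.single 0 1) (hRx : ∀ i, R (x₀ i) = x₀ (finRotate n i)) :
    fderiv ℝ (fun x : Fin n → EuclideanSpace ℝ (Fin 3) =>
        fderiv ℝ (S n) x (fun i => ‖x i‖ ^ 2 • (EuclideanSpace.single 0 1 : EuclideanSpace ℝ (Fin 3)) -
          (2 * inner ℝ (EuclideanSpace.single 0 1 : EuclideanSpace ℝ (Fin 3)) (x i)) • x i) -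
        2 * Δ * (∑ i, inner ℝ (EuclideanSpace.single 0 1 : EuclideanSpace ℝ (Fin 3)) (x i)) * S n x) x₀ = 0 := by
  -- notation
  set e0 : EuclideanSpace ℝ (Fin 3) := EuclideanSpace.single 0 1 with he0
  set D : (Fin n → EuclideanSpace ℝ (Fin 3)) → ℝ := fun x =>
    fderiv ℝ (S n) x (fun i => ‖x i‖ ^ 2 • e0 - (2 * inner ℝ e0 (x i)) • x i) - 2 * Δ * (∑ i, inner ℝ e0 (x i)) * S n x with hD
  -- differentiability of `D` at `x₀`
  have hDan : AnalyticOnNhd ℝ D (NonCoincident 3 n) :=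
    analyticOnNhd_defect (analyticOnNhd_limit hρ hlim hnorm hnd heuc hsc n) Δ e0
  have hDdiff : DifferentiableAt ℝ D x₀ := (hDan x₀ hx₀).differentiableAt
  have he0inner : ∀ u : EuclideanSpace ℝ (Fin 3), inner ℝ e0 u = u 0 := fun u => by
    rw [he0, EuclideanSpace.inner_single_left]; simp
  have he0e0 : inner ℝ e0 e0 = (1:ℝ) := by rw [he0inner]; simp [he0]
  -- lines through `x₀` stay non-coincident for small `t`
  have hline : ∀ v : Fin n → EuclideanSpace ℝ (Fin 3), ∀ᶠ t in 𝓝 (0:ℝ), x₀ + t • v ∈ NonCoincident 3 n := fun v => by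
    have hc : Tendsto (fun t : ℝ => x₀ + t • v) (𝓝 0) (𝓝 x₀) := by
      have : Continuous fun t : ℝ => x₀ + t • v := continuous_const.add (continuous_id.smul continuous_const)
      simpa using this.tendsto 0
    exact hc.eventually_mem ((isOpen_nonCoincident 3 n).mem_nhds hx₀)
  -- (I) constant-height directions are killed (free zeros II: `D` vanishes on configurations in planes `⊥ e₀`)
  have hH : ∀ (v : Fin n → EuclideanSpace ℝ (Fin 3)) (c : ℝ), (∀ i, inner ℝ e0 (v i) = c) → fderiv ℝ D x₀ v = 0 :=
      fun v c hv => by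
    refine stub_fderiv_apply_eq_zero_of_eventually_line n D x₀ v hDdiff ?_
    filter_upwards [hline v] with t ht
    have hpl : ∀ i, inner ℝ e0 ((x₀ + t • v) i) = h + t * c := fun i => by
      simp only [Pi.add_apply, Pi.smul_apply, inner_add_right, inner_smul_right, hplane i, hv i]
    exact limit_defect_eq_zero_of_coplanar hρ hlim hnorm hnd heuc hsc ht e0 (h + t * c) hpl
  -- (II) the symmetry `T δ = (R̂ δ) ∘ σ⁻¹`, `σ` the cyclic shift
  set σ : Equiv.Perm (Fin n) := finRotate n with hσ
  set T : (Fin n → EuclideanSpace ℝ (Fin 3)) →L[ℝ] (Fin n → EuclideanSpace ℝ (Fin 3)) :=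
    ContinuousLinearMap.pi fun i =>
      (R.toContinuousLinearEquiv : EuclideanSpace ℝ (Fin 3) →L[ℝ] EuclideanSpace ℝ (Fin 3)).comp
        (ContinuousLinearMap.proj (σ.symm i)) with hT
  have hTfun : ∀ δ : Fin n → EuclideanSpace ℝ (Fin 3), T δ = fun i => R (δ (σ.symm i)) := fun δ => rfl
  have hperm := isPermutationSymmetric_of_limit hlim hnorm
  have hinv : ∀ δ, D (x₀ + δ) = D (x₀ + T δ) := fun δ => by
    have h3 := defect_symm_transport n (S n) Δ (fun R' y => heuc.2 n R' y) (fun τ y => hperm n τ y) R σ x₀ hRx e0 hR0 δ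
    rw [hTfun]
    simpa only [hD] using h3
  have hTinv : ∀ δ, fderiv ℝ D x₀ δ = fderiv ℝ D x₀ (T δ) :=
    stub_fderiv_apply_eq_of_invariant n D x₀ T hDdiff hinv
  -- (III) the vertical functional `ℓ(h) = DD(x₀)[(hᵢ e₀)ᵢ]` is shift invariant and kills `(1,…,1)`, hence vanishes (N2)
  set V : (Fin n → ℝ) → (Fin n → EuclideanSpace ℝ (Fin 3)) := fun hv i => hv i • e0 with hV
  have hVadd : ∀ a a' : Fin n → ℝ, V (a + a') = V a + V a' := fun a a' => funext fun i => by
    simp [hV, add_smul]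
  have hVsmul : ∀ (c : ℝ) (a : Fin n → ℝ), V (c • a) = c • V a := fun c a => funext fun i => by
    simp [hV, smul_smul]
  let ℓ : (Fin n → ℝ) →ₗ[ℝ] ℝ :=
    { toFun := fun hv => fderiv ℝ D x₀ (V hv)
      map_add' := fun a a' => by simp only [hVadd, map_add]
      map_smul' := fun c a => by simp only [hVsmul, map_smul, RingHom.id_apply] }
  have hℓapply : ∀ hv, ℓ hv = fderiv ℝ D x₀ (V hv) := fun _ => rfl
  have hTV : ∀ hv : Fin n → ℝ, T (V hv) = V (hv ∘ σ.symm) := fun hv => funext fun i => by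
    simp only [hTfun, hV, Function.comp_apply, map_smul, hR0]
  have hℓrot : ∀ hv : Fin n → ℝ, ℓ (hv ∘ finRotate n) = ℓ hv := fun hv => by
    rw [hℓapply, hℓapply, hTinv (V (hv ∘ finRotate n)), hTV]
    congr 2
    rw [Function.comp_assoc, ← hσ, Equiv.self_comp_symm, Function.comp_id]
  have hℓone : ℓ (fun _ => 1) = 0 := by
    rw [hℓapply]
    exact hH _ 1 fun i => by simp only [hV, one_smul]; exact he0e0
  have hℓzero : ∀ hv, ℓ hv = 0 := stub_cyclicInvariant_eq_zero n ℓ hℓrot hℓone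
  -- (IV) every direction is constant-height + vertical
  refine ContinuousLinearMap.ext fun δ => ?_
  set hv : Fin n → ℝ := fun i => inner ℝ e0 (δ i) with hhv
  have hsplit : fderiv ℝ D x₀ δ = fderiv ℝ D x₀ (δ - V hv) + fderiv ℝ D x₀ (V hv) := by
    rw [← map_add, sub_add_cancel]
  have hhor : ∀ i, inner ℝ e0 ((δ - V hv) i) = 0 := fun i => by
    simp only [Pi.sub_apply, hV, hhv, inner_sub_right, inner_smul_right, he0e0, mul_one, sub_self]
  rw [hsplit, hH _ 0 hhor, ← hℓapply, hℓzero hv, add_zero]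
  simp

/-- **`fderiv` of the `K_{e₀}` defect of `S n` vanishes at the unit regular horizontal `n`-gon**, for every `n` and every normalised
non-degenerate Euclidean scale-covariant limit of `criticalCorr 3` (N1a, N1b feed the transitivity theorem). [cite: FrancescoMathieuSenechal1997, §4.3.1 (4.51)–(4.54)] -/
theorem limit_fderiv_defectK1_eq_zero_at_regularPolygon (hρ : ∀ δ ∈ Set.Ioc (0:ℝ) 1, 0 < ρ δ)
    (hlim : HasPointwiseScalingLimit (criticalCorr 3) ρ S)
    (hnorm : ∀ n z, z ∉ NonCoincident 3 n → S n z = 0) (hnd : IsNondegenerateTwoPoint S)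
    (heuc : IsEuclideanInvariant S) (hsc : IsScaleCovariant Δ S) (n : ℕ) :
    fderiv ℝ (fun x : Fin n → EuclideanSpace ℝ (Fin 3) =>
        fderiv ℝ (S n) x (fun i => ‖x i‖ ^ 2 • (EuclideanSpace.single 0 1 : EuclideanSpace ℝ (Fin 3)) -
          (2 * inner ℝ (EuclideanSpace.single 0 1 : EuclideanSpace ℝ (Fin 3)) (x i)) • x i) -
        2 * Δ * (∑ i, inner ℝ (EuclideanSpace.single 0 1 : EuclideanSpace ℝ (Fin 3)) (x i)) * S n x)
      (fun i : Fin n => Real.cos (2 * Real.pi * ((i : ℕ) : ℝ) / (n : ℝ)) • (EuclideanSpace.single 1 1 : EuclideanSpace ℝ (Fin 3)) +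
        Real.sin (2 * Real.pi * ((i : ℕ) : ℝ) / (n : ℝ)) • (EuclideanSpace.single 2 1 : EuclideanSpace ℝ (Fin 3))) = 0 := by
  obtain ⟨R, hR0, hRP⟩ := stub_regularPolygon_rotation n
  refine limit_fderiv_defectK1_eq_zero_of_cyclicSymmetry hρ hlim hnorm hnd heuc hsc
    (stub_regularPolygon_mem_nonCoincident n) 0 (fun i => ?_) R hR0 (fun i => hRP i)
  rw [EuclideanSpace.inner_single_left]
  simp

/-- **Orders `0` and `1` of the jet of the `K_{e₀}` defect of `S n` vanish at the unit regular horizontal `n`-gon**, for EVERY level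
`n` and every normalised non-degenerate Euclidean scale-covariant limit of `criticalCorr 3`, with no Ward identity assumed: in the jet
form of the crux the conformal content starts at order `2`, at every level. [cite: FrancescoMathieuSenechal1997, §4.3.1 (4.51)–(4.54)] -/
theorem limit_jetK1_order_le_one_eq_zero_at_regularPolygon (hρ : ∀ δ ∈ Set.Ioc (0:ℝ) 1, 0 < ρ δ)
    (hlim : HasPointwiseScalingLimit (criticalCorr 3) ρ S)
    (hnorm : ∀ n z, z ∉ NonCoincident 3 n → S n z = 0) (hnd : IsNondegenerateTwoPoint S)
    (heuc : IsEuclideanInvariant S) (hsc : IsScaleCovariant Δ S) (n : ℕ) {k : ℕ} (hk : k ≤ 1) :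
    iteratedFDeriv ℝ k (fun x : Fin n → EuclideanSpace ℝ (Fin 3) =>
        fderiv ℝ (S n) x (fun i => ‖x i‖ ^ 2 • (EuclideanSpace.single 0 1 : EuclideanSpace ℝ (Fin 3)) -
          (2 * inner ℝ (EuclideanSpace.single 0 1 : EuclideanSpace ℝ (Fin 3)) (x i)) • x i) -
        2 * Δ * (∑ i, inner ℝ (EuclideanSpace.single 0 1 : EuclideanSpace ℝ (Fin 3)) (x i)) * S n x)
      (fun i : Fin n => Real.cos (2 * Real.pi * ((i : ℕ) : ℝ) / (n : ℝ)) • (EuclideanSpace.single 1 1 : EuclideanSpace ℝ (Fin 3)) +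
        Real.sin (2 * Real.pi * ((i : ℕ) : ℝ) / (n : ℝ)) • (EuclideanSpace.single 2 1 : EuclideanSpace ℝ (Fin 3))) = 0 := by
  interval_cases k
  · -- order 0: the polygon lies in the plane `e₀^⊥` (free zeros II)
    ext m
    rw [iteratedFDeriv_zero_apply]
    refine limit_defect_eq_zero_of_coplanar hρ hlim hnorm hnd heuc hsc (stub_regularPolygon_mem_nonCoincident n)
      (EuclideanSpace.single 0 1) 0 fun i => ?_
    rw [EuclideanSpace.inner_single_left]
    simp
  · -- order 1: `iteratedFDeriv 1 = fderiv`
    ext m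
    rw [iteratedFDeriv_one_apply, limit_fderiv_defectK1_eq_zero_at_regularPolygon hρ hlim hnorm hnd heuc hsc n]
    simp

end Limit

/-! ## v20 §C. The registered residual of v20 (held by the lead): 7⁗_jet≥2 -/

/-- **7⁗_jet≥2 `stub_interiorWardK1JetGeTwo` (v20/v21's registered residual), DERIVED in v22 from 7⁗_jet≥2,odd
`MoebiusLimitExistsSketchV22.stub_interiorWardK1JetGeTwoOdd` by PARITY (`MoebiusLimitExistsSketchV22.jetK1_eq_zero_of_odd_vertical`).**  For a normalised non-degenerate
Euclidean scale-covariant pointwise scaling limit of the critical `ℤ³` Ising correlators on the interacting open-window stratum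
(window, `U₄ ≢ 0`, pointwise OS along the axes and clustering as FREE hypotheses), at every EVEN level `n ≥ 4` the iterated Fréchet
derivatives of ORDER `k ≥ 2` of the pointwise `K_{e₀}` defect `x ↦ DS_n(x)[(‖xᵢ‖²e₀ − 2⟪e₀,xᵢ⟫xᵢ)ᵢ] − 2Δ(Σᵢ⟪e₀,xᵢ⟫)S_n(x)`
vanish AT THE UNIT REGULAR HORIZONTAL `n`-GON `P_n i = cos(2πi/n) e₁ + sin(2πi/n) e₂`.  Orders `0, 1` are free there (§B), so this
is 7⁗_jet, hence (J1, local-to-global) 7⁗ and the crux given item 1981; it is crux-implied (tight, `crux_iff_entry_and_jetK1GeTwoStub`).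
CONTENT: the conformal Ward identity of the Ising₃ `σ`-sector as the list of Taylor coefficients of order `≥ 2` of ONE function at
ONE explicit configuration per even level.  No mechanism is claimed. [cite: FrancescoMathieuSenechal1997, §4.3.1 (4.51)–(4.54); DelamotteTissierWschebor2016, §5–6] -/
theorem stub_interiorWardK1JetGeTwo :
    ∀ (ρ : ℝ → ℝ) (Δ : ℝ) (S : CorrFamily 3), (∀ δ ∈ Set.Ioc (0:ℝ) 1, 0 < ρ δ) →
      HasPointwiseScalingLimit (criticalCorr 3) ρ S → (∀ n z, z ∉ NonCoincident 3 n → S n z = 0) →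
      IsNondegenerateTwoPoint S → IsEuclideanInvariant S → IsScaleCovariant Δ S →
      1 / 2 < Δ → Δ ≤ 3 / 4 → HasNontrivialU4 S →
      (∀ τ : Fin 3, PointwiseOSReconstruction τ S) →
      (∀ (n m : ℕ) (x : Fin n → EuclideanSpace ℝ (Fin 3)) (y : Fin m → EuclideanSpace ℝ (Fin 3))
        (v : EuclideanSpace ℝ (Fin 3)), v ≠ 0 →
        Tendsto (fun t : ℝ => S (n + m) (Fin.append x (fun j => y j + t • v)) - S n x * S m y)
          atTop (𝓝 0)) →
      ∀ n, 4 ≤ n → Even n → ∀ k : ℕ, 2 ≤ k →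
        iteratedFDeriv ℝ k (fun x : Fin n → EuclideanSpace ℝ (Fin 3) =>
          fderiv ℝ (S n) x (fun i => ‖x i‖ ^ 2 • (EuclideanSpace.single 0 1 : EuclideanSpace ℝ (Fin 3)) -
            (2 * inner ℝ (EuclideanSpace.single 0 1 : EuclideanSpace ℝ (Fin 3)) (x i)) • x i) -
          2 * Δ * (∑ i, inner ℝ (EuclideanSpace.single 0 1 : EuclideanSpace ℝ (Fin 3)) (x i)) * S n x)
          (fun i : Fin n => Real.cos (2 * Real.pi * ((i : ℕ) : ℝ) / (n : ℝ)) • (EuclideanSpace.single 1 1 : EuclideanSpace ℝ (Fin 3)) +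
            Real.sin (2 * Real.pi * ((i : ℕ) : ℝ) / (n : ℝ)) • (EuclideanSpace.single 2 1 : EuclideanSpace ℝ (Fin 3))) = 0 :=
  fun ρ Δ S hρ hlim hnorm hnd heuc hsc hlt hle hU4 hos hcl n hn4 he k hk =>
    MoebiusLimitExistsSketchV22.jetK1_eq_zero_of_odd_vertical n (S n) Δ (fun R y => heuc.2 n R y) _
      (fun i => by rw [EuclideanSpace.inner_single_left]; simp) k
      fun idx hodd => MoebiusLimitExistsSketchV22.stub_interiorWardK1JetGeTwoOdd ρ Δ S hρ hlim hnorm hnd heuc hsc hlt hle hU4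
        hos hcl n hn4 he k hk idx hodd

/-! ## v20 §D. TIGHTNESS: crux ⟺ 1981 ∧ 7⁗_jet≥2 (through c19's `jetK1_everywhere_of_jetK1EvenGeFour`) -/

open Summit.CriticalPhenomena.Ising3DConformalLimit.MoebiusLimitExistsJetDoor
  (jetK1_everywhere_of_jetK1EvenGeFour MoebiusLimitExists_iff_existence_and_jetK1WardStrict
    MoebiusLimitExists_of_existence_of_jetK1WardStrict)

/-- **The crux implies 7⁗_jet≥2** (crux ⇒ 7⁗_jet ⇒ the jet vanishes at EVERY configuration, in particular at `P_n` in orders `≥ 2`):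
the residual is necessary. [cite: DuminilCopinICM2022, §8.4] -/
theorem jetGeTwoStub_of_crux (hcrux : Theses.PerfectScreening.MoebiusLimitExists) :
    ∀ (ρ : ℝ → ℝ) (Δ : ℝ) (S : CorrFamily 3), (∀ δ ∈ Set.Ioc (0:ℝ) 1, 0 < ρ δ) →
      HasPointwiseScalingLimit (criticalCorr 3) ρ S → (∀ n z, z ∉ NonCoincident 3 n → S n z = 0) →
      IsNondegenerateTwoPoint S → IsEuclideanInvariant S → IsScaleCovariant Δ S →
      1 / 2 < Δ → Δ ≤ 3 / 4 → HasNontrivialU4 S →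
      (∀ τ : Fin 3, PointwiseOSReconstruction τ S) →
      (∀ (n m : ℕ) (x : Fin n → EuclideanSpace ℝ (Fin 3)) (y : Fin m → EuclideanSpace ℝ (Fin 3))
        (v : EuclideanSpace ℝ (Fin 3)), v ≠ 0 →
        Tendsto (fun t : ℝ => S (n + m) (Fin.append x (fun j => y j + t • v)) - S n x * S m y)
          atTop (𝓝 0)) →
      ∀ n, 4 ≤ n → Even n → ∀ k : ℕ, 2 ≤ k →
        iteratedFDeriv ℝ k (fun x : Fin n → EuclideanSpace ℝ (Fin 3) =>
          fderiv ℝ (S n) x (fun i => ‖x i‖ ^ 2 • (EuclideanSpace.single 0 1 : EuclideanSpace ℝ (Fin 3)) -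
            (2 * inner ℝ (EuclideanSpace.single 0 1 : EuclideanSpace ℝ (Fin 3)) (x i)) • x i) -
          2 * Δ * (∑ i, inner ℝ (EuclideanSpace.single 0 1 : EuclideanSpace ℝ (Fin 3)) (x i)) * S n x)
          (fun i : Fin n => Real.cos (2 * Real.pi * ((i : ℕ) : ℝ) / (n : ℝ)) • (EuclideanSpace.single 1 1 : EuclideanSpace ℝ (Fin 3)) +
            Real.sin (2 * Real.pi * ((i : ℕ) : ℝ) / (n : ℝ)) • (EuclideanSpace.single 2 1 : EuclideanSpace ℝ (Fin 3))) = 0 :=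
  fun ρ Δ S hρ hlim hnorm hnd heuc hsc hlt hle hU4 hos hcl n hn4 he k _ =>
    jetK1_everywhere_of_jetK1EvenGeFour hρ hlim hnorm hnd heuc hsc
      ((MoebiusLimitExists_iff_existence_and_jetK1WardStrict.1 hcrux).2 ρ Δ S hρ hlim hnorm hnd heuc hsc hlt hle hU4 hos hcl)
      n hn4 he _ (stub_regularPolygon_mem_nonCoincident n) k

/-- **TIGHTNESS of v20: `MoebiusLimitExists ⟺ ExistsScaleCovariantLimit (1981) ∧ 7⁗_jet≥2`** — the reshape 7⁗_jet → 7⁗_jet≥2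
(base point `P_n`, orders `0, 1` discharged by §B) drops no content. [cite: DuminilCopinICM2022, §8.4] -/
theorem crux_iff_entry_and_jetK1GeTwoStub :
    Theses.PerfectScreening.MoebiusLimitExists ↔
      Theses.HyperoctahedralRP.ExistsScaleCovariantLimit ∧
      (∀ (ρ : ℝ → ℝ) (Δ : ℝ) (S : CorrFamily 3), (∀ δ ∈ Set.Ioc (0:ℝ) 1, 0 < ρ δ) →
        HasPointwiseScalingLimit (criticalCorr 3) ρ S → (∀ n z, z ∉ NonCoincident 3 n → S n z = 0) →
        IsNondegenerateTwoPoint S → IsEuclideanInvariant S → IsScaleCovariant Δ S →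
        1 / 2 < Δ → Δ ≤ 3 / 4 → HasNontrivialU4 S →
        (∀ τ : Fin 3, PointwiseOSReconstruction τ S) →
        (∀ (n m : ℕ) (x : Fin n → EuclideanSpace ℝ (Fin 3)) (y : Fin m → EuclideanSpace ℝ (Fin 3))
          (v : EuclideanSpace ℝ (Fin 3)), v ≠ 0 →
          Tendsto (fun t : ℝ => S (n + m) (Fin.append x (fun j => y j + t • v)) - S n x * S m y)
            atTop (𝓝 0)) →
        ∀ n, 4 ≤ n → Even n → ∀ k : ℕ, 2 ≤ k →
          iteratedFDeriv ℝ k (fun x : Fin n → EuclideanSpace ℝ (Fin 3) =>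
            fderiv ℝ (S n) x (fun i => ‖x i‖ ^ 2 • (EuclideanSpace.single 0 1 : EuclideanSpace ℝ (Fin 3)) -
              (2 * inner ℝ (EuclideanSpace.single 0 1 : EuclideanSpace ℝ (Fin 3)) (x i)) • x i) -
            2 * Δ * (∑ i, inner ℝ (EuclideanSpace.single 0 1 : EuclideanSpace ℝ (Fin 3)) (x i)) * S n x)
            (fun i : Fin n => Real.cos (2 * Real.pi * ((i : ℕ) : ℝ) / (n : ℝ)) • (EuclideanSpace.single 1 1 : EuclideanSpace ℝ (Fin 3)) +
              Real.sin (2 * Real.pi * ((i : ℕ) : ℝ) / (n : ℝ)) • (EuclideanSpace.single 2 1 : EuclideanSpace ℝ (Fin 3))) = 0) :=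
  ⟨fun hcrux => ⟨MoebiusLimitExistsOnlyInteraction.existsScaleCovariantLimit_of_MoebiusLimitExists hcrux, jetGeTwoStub_of_crux hcrux⟩,
    fun ⟨hE, h7⟩ => MoebiusLimitExists_of_existence_of_jetK1WardStrict hE
      fun ρ Δ S hρ hlim hnorm hnd heuc hsc hlt hle hU4 hos hcl n hn4 he =>
        ⟨_, stub_regularPolygon_mem_nonCoincident n, fun k => by
          rcases Nat.lt_or_ge k 2 with hk | hk
          · exact limit_jetK1_order_le_one_eq_zero_at_regularPolygon hρ hlim hnorm hnd heuc hsc n (by omega)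
          · exact h7 ρ Δ S hρ hlim hnorm hnd heuc hsc hlt hle hU4 hos hcl n hn4 he k hk⟩⟩

/-- **TIGHTNESS of v22: `MoebiusLimitExists ⟺ ExistsScaleCovariantLimit (1981) ∧ 7⁗_jet≥2,odd`** — the parity reshape drops no
content (⇒: specialise 7⁗_jet≥2 to basis tuples; ⇐: parity + P2 give 7⁗_jet≥2). [cite: DuminilCopinICM2022, §8.4] -/
theorem crux_iff_entry_and_jetK1GeTwoOddStub :
    Theses.PerfectScreening.MoebiusLimitExists ↔
      Theses.HyperoctahedralRP.ExistsScaleCovariantLimit ∧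
      (∀ (ρ : ℝ → ℝ) (Δ : ℝ) (S : CorrFamily 3), (∀ δ ∈ Set.Ioc (0:ℝ) 1, 0 < ρ δ) →
        HasPointwiseScalingLimit (criticalCorr 3) ρ S → (∀ n z, z ∉ NonCoincident 3 n → S n z = 0) →
        IsNondegenerateTwoPoint S → IsEuclideanInvariant S → IsScaleCovariant Δ S →
        1 / 2 < Δ → Δ ≤ 3 / 4 → HasNontrivialU4 S →
        (∀ τ : Fin 3, PointwiseOSReconstruction τ S) →
        (∀ (n m : ℕ) (x : Fin n → EuclideanSpace ℝ (Fin 3)) (y : Fin m → EuclideanSpace ℝ (Fin 3))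
          (v : EuclideanSpace ℝ (Fin 3)), v ≠ 0 →
          Tendsto (fun t : ℝ => S (n + m) (Fin.append x (fun j => y j + t • v)) - S n x * S m y)
            atTop (𝓝 0)) →
        ∀ n, 4 ≤ n → Even n → ∀ k : ℕ, 2 ≤ k → ∀ idx : Fin k → Fin n × Fin 3,
          Odd (Finset.univ.filter fun j => (idx j).2 = 0).card →
          iteratedFDeriv ℝ k (fun x : Fin n → EuclideanSpace ℝ (Fin 3) =>
            fderiv ℝ (S n) x (fun i => ‖x i‖ ^ 2 • (EuclideanSpace.single 0 1 : EuclideanSpace ℝ (Fin 3)) -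
              (2 * inner ℝ (EuclideanSpace.single 0 1 : EuclideanSpace ℝ (Fin 3)) (x i)) • x i) -
            2 * Δ * (∑ i, inner ℝ (EuclideanSpace.single 0 1 : EuclideanSpace ℝ (Fin 3)) (x i)) * S n x)
            (fun i : Fin n => Real.cos (2 * Real.pi * ((i : ℕ) : ℝ) / (n : ℝ)) • (EuclideanSpace.single 1 1 : EuclideanSpace ℝ (Fin 3)) +
              Real.sin (2 * Real.pi * ((i : ℕ) : ℝ) / (n : ℝ)) • (EuclideanSpace.single 2 1 : EuclideanSpace ℝ (Fin 3)))
            (fun j => Pi.single (idx j).1 (EuclideanSpace.single (idx j).2 (1:ℝ))) = 0) := by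
  rw [crux_iff_entry_and_jetK1GeTwoStub]
  refine and_congr_right fun _ => ?_
  refine forall_congr' fun ρ => forall_congr' fun Δ => forall_congr' fun S => forall_congr' fun _ =>
    forall_congr' fun _ => forall_congr' fun _ => forall_congr' fun _ => forall_congr' fun heuc =>
    forall_congr' fun _ => forall_congr' fun _ => forall_congr' fun _ => forall_congr' fun _ =>
    forall_congr' fun _ => forall_congr' fun _ => forall_congr' fun n => forall_congr' fun _ =>
    forall_congr' fun _ => forall_congr' fun k => forall_congr' fun _ => ?_
  exact ⟨fun h idx _ => by rw [h]; rfl,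
    fun h => MoebiusLimitExistsSketchV22.jetK1_eq_zero_of_odd_vertical n (S n) Δ (fun R y => heuc.2 n R y) _
      (fun i => by rw [EuclideanSpace.inner_single_left]; simp) k h⟩

end Summit.CriticalPhenomena.Ising3DConformalLimit.MoebiusLimitExistsSketchV20

namespace Summit.CriticalPhenomena.Ising3DConformalLimit.MoebiusLimitExistsSketchV16

/-! ## A/B. The pure-analysis stubs of v16 are LANDED (wave 1 of lead c19, six stub-workers, one message, all `stub-landed` within 16 min):
Z1 `stub_defect_rotate` p160640 (`Theorems/PlantedPinningMoebiusLimitExistsDefectRotate.lean`), Z2 `stub_defect_perm` p160639 (`…DefectPerm.lean`),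
Z3 `stub_fderiv_rotationGenerator` p160916 (`…RotationGenerator.lean`), Z4 `stub_defect_translate` p160616 (`…DefectTranslate.lean`),
Z5 `stub_defect_dilate` p160758 (`…DefectDilate.lean`), J1 `stub_eventuallyEq_zero_of_jet` p160597 (`…JetVanishing.lean`) — all in this namespace, imported above.
Their consequences (free zeros of the defect of Ising₃ limits at centrally symmetric / coplanar-⊥-generator configurations, translation invariance and dilation
homogeneity of the defect, the order-0 jet coefficient of 7⁗_jet free at such configurations) are the lead's file `Theorems/PlantedPinningMoebiusLimitExistsDefectSymmetry.lean`;
the tightness `crux ⟺ 1981 ∧ 7⁗_jet` and `1982 ⟺ bare jet upgrade` are the lead's file `Theorems/PlantedPinningMoebiusLimitExistsJetDoor.lean` (p160981). -/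

/-! ## E (v18). ORDER-1 FREENESS of 7⁗_jet at the horizontal square (`n = 4`): registered stubs Y1, Y3 (wave 2 of lead c19), assembly by the lead
(`Theorems/PlantedPinningMoebiusLimitExistsSquareJet.lean`): at `x₀ = (a e₁, a e₂, −a e₁, −a e₂)` the defect `E_{e₀}(S 4)` vanishes on the two free-zero loci
of `…DefectSymmetry.lean` through `x₀` (equal heights; `x 0 + x 2 = x 1 + x 3`) and on the twisted family `x₀ + t(e₀, −e₀, e₀, −e₀)` (improper rotation Y1
permuting the points cyclically and reversing `e₀`), whose directions span `(ℝ³)⁴`; hence `fderiv (E_{e₀}(S 4)) x₀ = 0`: orders `0` and `1` of the jet are FREE,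
the conformal content of `S₄` at the square starts at order `2`. -/

/-! Y1 `stub_squareTwist_isometry` LANDED p161882 (`Theorems/PlantedPinningMoebiusLimitExistsSquareTwist.lean`), Y3 `stub_fderiv_apply_eq_zero_of_eventually_line`
LANDED p161786 (`…LineDeriv.lean`) — wave 2 of lead c19 (two stub-workers, one message, both `stub-landed` within 6 min), imported above; the assembly
(`limit_fderiv_defectK1_eq_zero_at_square`, `limit_jetK1_order_le_one_eq_zero_at_square`, covector principle `defect_map_generator_of_symmetry`) is the
lead's file `Theorems/PlantedPinningMoebiusLimitExistsSquareJet.lean` (p162372).  Evidence `square-jet-count.md` (exact linear algebra): at order 2 at most 2 of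
the 78 Hessian entries of the defect at the square are not forced to vanish by these symmetries — the first conformal datum of `S₄` there. -/

/-! ## C. The registered residual of v16 (held by the lead): 7⁗_jet -/

/-- **STUB 7⁗_jet (XXL, THE HARDEST — held by the lead) — `stub_interiorWardK1Jet`.**  For a normalised non-degenerate Euclidean
scale-covariant pointwise scaling limit of the critical `ℤ³` Ising correlators on the interacting open-window stratum (window, `U₄ ≢ 0`,
pointwise OS along the axes and clustering as FREE hypotheses), at every EVEN level `n ≥ 4` there is ONE non-coincident configuration `x₀`
at which the TAYLOR JET of the pointwise `K_{e₀}` defect `x ↦ DS_n(x)[(‖xᵢ‖²e₀ − 2⟪e₀,xᵢ⟫xᵢ)ᵢ] − 2Δ(Σᵢ⟪e₀,xᵢ⟫)S_n(x)` vanishes to all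
orders.  By real-analyticity of the limit (p157368) and J1 this is 7⁗_loc, hence (local-to-global) 7⁗ and the crux given item 1981; it is
crux-implied (tight).  CONTENT: the conformal Ward identity of the Ising₃ `σ`-sector as a statement about the Taylor coefficients of ONE
function at ONE configuration per even level; by §A the order-0 coefficient (and more) is FREE at a centrally symmetric coplanar `x₀`.
No mechanism is claimed. [cite: FrancescoMathieuSenechal1997, §4.3.1 (4.51)–(4.54); DelamotteTissierWschebor2016, §5–6]
**v20: DERIVED** from 7⁗_jet≥2 `MoebiusLimitExistsSketchV20.stub_interiorWardK1JetGeTwo` with base point the unit regular horizontal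
`n`-gon (N1a) and orders `0, 1` discharged by transitivity (`MoebiusLimitExistsSketchV20.limit_jetK1_order_le_one_eq_zero_at_regularPolygon`). -/
theorem stub_interiorWardK1Jet :
    ∀ (ρ : ℝ → ℝ) (Δ : ℝ) (S : CorrFamily 3), (∀ δ ∈ Set.Ioc (0:ℝ) 1, 0 < ρ δ) →
      HasPointwiseScalingLimit (criticalCorr 3) ρ S → (∀ n z, z ∉ NonCoincident 3 n → S n z = 0) →
      IsNondegenerateTwoPoint S → IsEuclideanInvariant S → IsScaleCovariant Δ S →
      1 / 2 < Δ → Δ ≤ 3 / 4 → HasNontrivialU4 S →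
      (∀ τ : Fin 3, PointwiseOSReconstruction τ S) →
      (∀ (n m : ℕ) (x : Fin n → EuclideanSpace ℝ (Fin 3)) (y : Fin m → EuclideanSpace ℝ (Fin 3))
        (v : EuclideanSpace ℝ (Fin 3)), v ≠ 0 →
        Tendsto (fun t : ℝ => S (n + m) (Fin.append x (fun j => y j + t • v)) - S n x * S m y)
          atTop (𝓝 0)) →
      ∀ n, 4 ≤ n → Even n → ∃ x₀ ∈ NonCoincident 3 n, ∀ k : ℕ,
        iteratedFDeriv ℝ k (fun x : Fin n → EuclideanSpace ℝ (Fin 3) =>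
          fderiv ℝ (S n) x (fun i => ‖x i‖ ^ 2 • (EuclideanSpace.single 0 1 : EuclideanSpace ℝ (Fin 3)) -
            (2 * inner ℝ (EuclideanSpace.single 0 1 : EuclideanSpace ℝ (Fin 3)) (x i)) • x i) -
          2 * Δ * (∑ i, inner ℝ (EuclideanSpace.single 0 1 : EuclideanSpace ℝ (Fin 3)) (x i)) * S n x) x₀ = 0 :=
  fun ρ Δ S hρ hlim hnorm hnd heuc hsc hlt hle hU4 hos hcl n hn4 he =>
    ⟨_, MoebiusLimitExistsSketchV20.stub_regularPolygon_mem_nonCoincident n, fun k => by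
      rcases Nat.lt_or_ge k 2 with hk | hk
      · exact MoebiusLimitExistsSketchV20.limit_jetK1_order_le_one_eq_zero_at_regularPolygon hρ hlim hnorm hnd heuc hsc n
          (by omega)
      · exact MoebiusLimitExistsSketchV20.stub_interiorWardK1JetGeTwo ρ Δ S hρ hlim hnorm hnd heuc hsc hlt hle hU4 hos hcl
          n hn4 he k hk⟩

/-! ## D. 7⁗_loc from 7⁗_jet (lead): analyticity of the limit + J1 + C1 -/

open Summit.CriticalPhenomena.Ising3DConformalLimit.MoebiusLimitExistsLocalWard (analyticOnNhd_limit analyticOnNhd_defect)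
open Summit.CriticalPhenomena.Ising3DConformalLimit.MoebiusLimitExistsSketchV13 (stub_ward_of_pointwise)

/-- **A vanishing jet of the defect at one configuration gives the local weak Ward identity** (one level, one generator, any weight):
the defect of the real-analytic level is real-analytic (`analyticOnNhd_defect`), vanishes near `x₀` by J1, so the pointwise identity holds
on an open neighbourhood `V ⊆ NonCoincident` of `x₀`, and integrates to the weak identity for tests supported in `V` (C1). [cite: GlimmJaffe1987, §6.1 Thm 6.1.3] -/
theorem localWard_of_jet {n : ℕ} {F : (Fin n → EuclideanSpace ℝ (Fin 3)) → ℝ} (hF : AnalyticOnNhd ℝ F (NonCoincident 3 n))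
    (Δ' : ℝ) (b : EuclideanSpace ℝ (Fin 3)) {x₀ : Fin n → EuclideanSpace ℝ (Fin 3)} (hx₀ : x₀ ∈ NonCoincident 3 n)
    (hjet : ∀ k : ℕ, iteratedFDeriv ℝ k (fun x : Fin n → EuclideanSpace ℝ (Fin 3) =>
      fderiv ℝ F x (fun i => ‖x i‖ ^ 2 • b - (2 * inner ℝ b (x i)) • x i) - 2 * Δ' * (∑ i, inner ℝ b (x i)) * F x) x₀ = 0) :
    ∃ V : Set (Fin n → EuclideanSpace ℝ (Fin 3)), IsOpen V ∧ V.Nonempty ∧ V ⊆ NonCoincident 3 n ∧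
      ∀ (φ : (Fin n → EuclideanSpace ℝ (Fin 3)) → ℝ),
        ContDiff ℝ ((⊤ : ℕ∞) : WithTop ℕ∞) φ → HasCompactSupport φ → tsupport φ ⊆ V →
        ∫ x, F x * ((2 * Δ' - 6) * (∑ i, inner ℝ b (x i)) * φ x +
          fderiv ℝ φ x (fun i => ‖x i‖ ^ 2 • b - (2 * inner ℝ b (x i)) • x i)) = 0 := by
  set D : (Fin n → EuclideanSpace ℝ (Fin 3)) → ℝ := fun x =>
    fderiv ℝ F x (fun i => ‖x i‖ ^ 2 • b - (2 * inner ℝ b (x i)) • x i) - 2 * Δ' * (∑ i, inner ℝ b (x i)) * F x with hD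
  have hDan : AnalyticOnNhd ℝ D (NonCoincident 3 n) := analyticOnNhd_defect hF Δ' b
  have hD0 : D =ᶠ[𝓝 x₀] 0 := stub_eventuallyEq_zero_of_jet n D x₀ (hDan x₀ hx₀) hjet
  have hboth : ∀ᶠ x in 𝓝 x₀, D x = (0 : (Fin n → EuclideanSpace ℝ (Fin 3)) → ℝ) x ∧ x ∈ NonCoincident 3 n :=
    hD0.and ((isOpen_nonCoincident 3 n).mem_nhds hx₀)
  obtain ⟨V, hVsub, hV, hxV⟩ := _root_.eventually_nhds_iff.1 hboth
  refine ⟨V, hV, ⟨x₀, hxV⟩, fun x hx => (hVsub x hx).2, ?_⟩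
  refine stub_ward_of_pointwise n F Δ' b V hV (hF.mono fun x hx => (hVsub x hx).2) ?_
  intro x hx
  have h := (hVsub x hx).1
  simp only [hD, Pi.zero_apply, sub_eq_zero] at h
  exact h

/-- **7⁗_loc from 7⁗_jet** for Ising₃ limits (real-analyticity of the limit on all of `NonCoincident`, `analyticOnNhd_limit`). [cite: GlimmJaffe1987, §6.1 Thm 6.1.3] -/
theorem wardK1Local_of_jet :
    ∀ (ρ : ℝ → ℝ) (Δ : ℝ) (S : CorrFamily 3), (∀ δ ∈ Set.Ioc (0:ℝ) 1, 0 < ρ δ) →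
      HasPointwiseScalingLimit (criticalCorr 3) ρ S → (∀ n z, z ∉ NonCoincident 3 n → S n z = 0) →
      IsNondegenerateTwoPoint S → IsEuclideanInvariant S → IsScaleCovariant Δ S →
      1 / 2 < Δ → Δ ≤ 3 / 4 → HasNontrivialU4 S →
      (∀ τ : Fin 3, PointwiseOSReconstruction τ S) →
      (∀ (n m : ℕ) (x : Fin n → EuclideanSpace ℝ (Fin 3)) (y : Fin m → EuclideanSpace ℝ (Fin 3))
        (v : EuclideanSpace ℝ (Fin 3)), v ≠ 0 →
        Tendsto (fun t : ℝ => S (n + m) (Fin.append x (fun j => y j + t • v)) - S n x * S m y)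
          atTop (𝓝 0)) →
      ∀ n, 4 ≤ n → Even n → ∃ V : Set (Fin n → EuclideanSpace ℝ (Fin 3)),
        IsOpen V ∧ V.Nonempty ∧ V ⊆ NonCoincident 3 n ∧
        ∀ (φ : (Fin n → EuclideanSpace ℝ (Fin 3)) → ℝ),
          ContDiff ℝ ((⊤ : ℕ∞) : WithTop ℕ∞) φ → HasCompactSupport φ → tsupport φ ⊆ V →
          ∫ x, S n x * ((2 * Δ - 6) * (∑ i, inner ℝ (EuclideanSpace.single 0 1 : EuclideanSpace ℝ (Fin 3)) (x i)) * φ x +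
            fderiv ℝ φ x (fun i => ‖x i‖ ^ 2 • (EuclideanSpace.single 0 1 : EuclideanSpace ℝ (Fin 3)) -
              (2 * inner ℝ (EuclideanSpace.single 0 1 : EuclideanSpace ℝ (Fin 3)) (x i)) • x i)) = 0 :=
  fun ρ Δ S hρ hlim hnorm hnd heuc hsc hlt hle hU4 hos hcl n hn4 he => by
    obtain ⟨x₀, hx₀, hjet⟩ := stub_interiorWardK1Jet ρ Δ S hρ hlim hnorm hnd heuc hsc hlt hle hU4 hos hcl n hn4 he
    exact localWard_of_jet (analyticOnNhd_limit hρ hlim hnorm hnd heuc hsc n) Δ (EuclideanSpace.single 0 1) hx₀ hjet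

end Summit.CriticalPhenomena.Ising3DConformalLimit.MoebiusLimitExistsSketchV16

namespace Summit.CriticalPhenomena.Ising3DConformalLimit.MoebiusLimitExistsSketchV13

local notation "E3" => EuclideanSpace ℝ (Fin 3)

/-! ## v15: the analysis of v13 is LANDED — P1 `stub_nonCoincident_pathConnected` (p156713), P2 `stub_exists_goodFrame` (p156669),
C1 `stub_ward_of_pointwise` (p157117), C2 `stub_pointwise_of_ward` (p156884), and the lead's D-layer `MoebiusLimitExistsLocalWard.analyticOnNhd_limit`
/ `analyticOnNhd_defect` / `ward_of_localWard` / `sctWardWeak_of_localWard` (p157368, `Theorems/PlantedPinningMoebiusLimitExistsLocalWard.lean`). -/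

open Summit.CriticalPhenomena.Ising3DConformalLimit.MoebiusLimitExistsLocalWard (ward_of_localWard)

/-! ## The registered residual of v13 (held by the lead) and the derivation of 7⁗ -/

/-- **7⁗_loc `stub_interiorWardK1Local` (v13–v15's registered residual), DERIVED in v16 from 7⁗_jet (`MoebiusLimitExistsSketchV16.wardK1Local_of_jet`).**  For a normalised non-degenerate
Euclidean scale-covariant pointwise scaling limit of the critical `ℤ³` Ising correlators on the interacting open-window stratum
(`1/2 < Δ ≤ 3/4`, `U₄ ≢ 0`; pointwise OS premises along the three axes and clustering as FREE hypotheses), at every EVEN level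
`n ≥ 4` there is SOME non-empty open set `V` of non-coincident `n`-point configurations on which the weak special-conformal Ward
identity with weight `Δ` for the single generator `K_{e₀}` (`e₀ = EuclideanSpace.single 0 1`) holds, i.e. for all smooth tests
compactly supported in `V`.  By LOCAL-TO-GLOBAL (`ward_of_localWard`: real-analyticity of the limit on the connected configuration
space) this is equivalent to 7⁗; CONTENT: the conformal Ward identity of the Ising₃ `σ`-sector GERM-WISE — near one configuration per
even level.  No mechanism is claimed. [cite: FrancescoMathieuSenechal1997, §4.3.1 (4.51)–(4.54); DelamotteTissierWschebor2016, §5–6] -/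
theorem stub_interiorWardK1Local :
    ∀ (ρ : ℝ → ℝ) (Δ : ℝ) (S : CorrFamily 3), (∀ δ ∈ Set.Ioc (0:ℝ) 1, 0 < ρ δ) →
      HasPointwiseScalingLimit (criticalCorr 3) ρ S → (∀ n z, z ∉ NonCoincident 3 n → S n z = 0) →
      IsNondegenerateTwoPoint S → IsEuclideanInvariant S → IsScaleCovariant Δ S →
      1 / 2 < Δ → Δ ≤ 3 / 4 → HasNontrivialU4 S →
      (∀ τ : Fin 3, PointwiseOSReconstruction τ S) →
      (∀ (n m : ℕ) (x : Fin n → EuclideanSpace ℝ (Fin 3)) (y : Fin m → EuclideanSpace ℝ (Fin 3))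
        (v : EuclideanSpace ℝ (Fin 3)), v ≠ 0 →
        Tendsto (fun t : ℝ => S (n + m) (Fin.append x (fun j => y j + t • v)) - S n x * S m y)
          atTop (𝓝 0)) →
      ∀ n, 4 ≤ n → Even n → ∃ V : Set (Fin n → EuclideanSpace ℝ (Fin 3)),
        IsOpen V ∧ V.Nonempty ∧ V ⊆ NonCoincident 3 n ∧
        ∀ (φ : (Fin n → EuclideanSpace ℝ (Fin 3)) → ℝ),
          ContDiff ℝ ((⊤ : ℕ∞) : WithTop ℕ∞) φ → HasCompactSupport φ → tsupport φ ⊆ V →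
          ∫ x, S n x * ((2 * Δ - 6) * (∑ i, inner ℝ (EuclideanSpace.single 0 1 : EuclideanSpace ℝ (Fin 3)) (x i)) * φ x +
            fderiv ℝ φ x (fun i => ‖x i‖ ^ 2 • (EuclideanSpace.single 0 1 : EuclideanSpace ℝ (Fin 3)) -
              (2 * inner ℝ (EuclideanSpace.single 0 1 : EuclideanSpace ℝ (Fin 3)) (x i)) • x i)) = 0 :=
  MoebiusLimitExistsSketchV16.wardK1Local_of_jet

/-- **7⁗ from 7⁗_loc** (local-to-global, `ward_of_localWard`). [cite: GlimmJaffe1987, §6.1 Thm 6.1.3] -/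
theorem k1EvenGeFour_of_local :
    ∀ (ρ : ℝ → ℝ) (Δ : ℝ) (S : CorrFamily 3), (∀ δ ∈ Set.Ioc (0:ℝ) 1, 0 < ρ δ) →
      HasPointwiseScalingLimit (criticalCorr 3) ρ S → (∀ n z, z ∉ NonCoincident 3 n → S n z = 0) →
      IsNondegenerateTwoPoint S → IsEuclideanInvariant S → IsScaleCovariant Δ S →
      1 / 2 < Δ → Δ ≤ 3 / 4 → HasNontrivialU4 S →
      (∀ τ : Fin 3, PointwiseOSReconstruction τ S) →
      (∀ (n m : ℕ) (x : Fin n → EuclideanSpace ℝ (Fin 3)) (y : Fin m → EuclideanSpace ℝ (Fin 3))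
        (v : EuclideanSpace ℝ (Fin 3)), v ≠ 0 →
        Tendsto (fun t : ℝ => S (n + m) (Fin.append x (fun j => y j + t • v)) - S n x * S m y)
          atTop (𝓝 0)) →
      ∀ n, 4 ≤ n → Even n → ∀ (φ : (Fin n → EuclideanSpace ℝ (Fin 3)) → ℝ),
        ContDiff ℝ ((⊤ : ℕ∞) : WithTop ℕ∞) φ → HasCompactSupport φ → tsupport φ ⊆ NonCoincident 3 n →
        ∫ x, S n x * ((2 * Δ - 6) * (∑ i, inner ℝ (EuclideanSpace.single 0 1 : EuclideanSpace ℝ (Fin 3)) (x i)) * φ x +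
          fderiv ℝ φ x (fun i => ‖x i‖ ^ 2 • (EuclideanSpace.single 0 1 : EuclideanSpace ℝ (Fin 3)) -
            (2 * inner ℝ (EuclideanSpace.single 0 1 : EuclideanSpace ℝ (Fin 3)) (x i)) • x i)) = 0 :=
  fun ρ Δ S hρ hlim hnorm hnd heuc hsc hlt hle hU4 hos hcl n hn4 he => by
    obtain ⟨V, hV, hVne, hVsub, hloc⟩ := stub_interiorWardK1Local ρ Δ S hρ hlim hnorm hnd heuc hsc hlt hle hU4 hos hcl n hn4 he
    exact ward_of_localWard hρ hlim hnorm hnd heuc hsc Δ (EuclideanSpace.single 0 1) hV hVne hVsub hloc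

end Summit.CriticalPhenomena.Ising3DConformalLimit.MoebiusLimitExistsSketchV13

namespace Summit.CriticalPhenomena.Ising3DConformalLimit.MoebiusLimitExistsSketchV11

open Summit.CriticalPhenomena.Ising3DConformalLimit.MoebiusLimitExistsSketchV9
  (stub_weakTranslation stub_wardOnU0 stub_wardOfWardOnU0)

/-! ## The registered stub (the only `sorry`) -/

/-- **7⁗ `stub_interiorWardK1EvenGeFour` (v11/v12's registered residual), DERIVED in v13 from the LOCAL residual 7⁗_loc
`MoebiusLimitExistsSketchV13.stub_interiorWardK1Local` by local-to-global (`MoebiusLimitExistsSketchV13.ward_of_localWard`).**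
For a normalised non-degenerate Euclidean scale-covariant pointwise scaling limit of the critical `ℤ³` Ising correlators on the
interacting open-window stratum, every EVEN level `n ≥ 4` satisfies the weak special-conformal Ward identity with weight `Δ` for the
single generator `K_{e₀}`. [cite: FrancescoMathieuSenechal1997, §4.3.1 (4.51)–(4.54); DelamotteTissierWschebor2016, §5–6] -/
theorem stub_interiorWardK1EvenGeFour :
    ∀ (ρ : ℝ → ℝ) (Δ : ℝ) (S : CorrFamily 3), (∀ δ ∈ Set.Ioc (0:ℝ) 1, 0 < ρ δ) →
      HasPointwiseScalingLimit (criticalCorr 3) ρ S → (∀ n z, z ∉ NonCoincident 3 n → S n z = 0) →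
      IsNondegenerateTwoPoint S → IsEuclideanInvariant S → IsScaleCovariant Δ S →
      1 / 2 < Δ → Δ ≤ 3 / 4 → HasNontrivialU4 S →
      (∀ τ : Fin 3, PointwiseOSReconstruction τ S) →
      (∀ (n m : ℕ) (x : Fin n → EuclideanSpace ℝ (Fin 3)) (y : Fin m → EuclideanSpace ℝ (Fin 3))
        (v : EuclideanSpace ℝ (Fin 3)), v ≠ 0 →
        Tendsto (fun t : ℝ => S (n + m) (Fin.append x (fun j => y j + t • v)) - S n x * S m y)
          atTop (𝓝 0)) →
      ∀ n, 4 ≤ n → Even n → ∀ (φ : (Fin n → EuclideanSpace ℝ (Fin 3)) → ℝ),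
        ContDiff ℝ ((⊤ : ℕ∞) : WithTop ℕ∞) φ → HasCompactSupport φ → tsupport φ ⊆ NonCoincident 3 n →
        ∫ x, S n x * ((2 * Δ - 6) * (∑ i, inner ℝ (EuclideanSpace.single 0 1 : EuclideanSpace ℝ (Fin 3)) (x i)) * φ x +
          fderiv ℝ φ x (fun i => ‖x i‖ ^ 2 • (EuclideanSpace.single 0 1 : EuclideanSpace ℝ (Fin 3)) -
            (2 * inner ℝ (EuclideanSpace.single 0 1 : EuclideanSpace ℝ (Fin 3)) (x i)) • x i)) = 0 :=
  MoebiusLimitExistsSketchV13.k1EvenGeFour_of_local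

/-! W1 `stub_wardOfWardDir` and W0 `stub_wardLowLevels` are LANDED (p154558 `Theorems/PlantedPinningMoebiusLimitExistsWardOfWardDir.lean`,
p154617 `Theorems/PlantedPinningMoebiusLimitExistsWardLowLevels.lean`, namespace `MoebiusLimitExistsSketchV11`, imported above). -/

/-! ## The door (landed: `Theorems/PlantedPinningMoebiusLimitExistsWardDoor.lean`, p145428) -/

open Summit.CriticalPhenomena.Ising3DConformalLimit.MoebiusLimitExistsWardDoor
  (sctWardWeak_three_iff isMoebiusCovariant_of_limit_of_sctWardWeak)

/-- The chosen generator `e₀ = EuclideanSpace.single 0 1` is non-zero. [folklore] -/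
theorem single_zero_one_ne_zero : (EuclideanSpace.single 0 1 : EuclideanSpace ℝ (Fin 3)) ≠ 0 := fun h => by
  simpa using congrArg (fun v : EuclideanSpace ℝ (Fin 3) => v 0) h

/-- **From the single-generator identity at even levels `≥ 4` to all weak Ward identities** (W0 for `n < 4` and odd `n`; W1 and
`O(3)` invariance for the other generators). [cite: FrancescoMathieuSenechal1997, §4.3.1 (4.51)–(4.54)] -/
theorem sctWardWeak_all_of_k1EvenGeFour {ρ : ℝ → ℝ} {Δ : ℝ} {S : CorrFamily 3}
    (hlim : HasPointwiseScalingLimit (criticalCorr 3) ρ S) (hnorm : ∀ n z, z ∉ NonCoincident 3 n → S n z = 0)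
    (heuc : IsEuclideanInvariant S) (hsc : IsScaleCovariant Δ S)
    (hK1 : ∀ n, 4 ≤ n → Even n → ∀ (φ : (Fin n → EuclideanSpace ℝ (Fin 3)) → ℝ),
        ContDiff ℝ ((⊤ : ℕ∞) : WithTop ℕ∞) φ → HasCompactSupport φ → tsupport φ ⊆ NonCoincident 3 n →
        ∫ x, S n x * ((2 * Δ - 6) * (∑ i, inner ℝ (EuclideanSpace.single 0 1 : EuclideanSpace ℝ (Fin 3)) (x i)) * φ x +
          fderiv ℝ φ x (fun i => ‖x i‖ ^ 2 • (EuclideanSpace.single 0 1 : EuclideanSpace ℝ (Fin 3)) -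
            (2 * inner ℝ (EuclideanSpace.single 0 1 : EuclideanSpace ℝ (Fin 3)) (x i)) • x i)) = 0) :
    ∀ n, SCTWardWeak S Δ n := fun n => by
  rcases Nat.lt_or_ge n 4 with hn4 | hn4
  · exact stub_wardLowLevels ρ Δ S hlim hnorm heuc hsc n (Or.inl hn4)
  rcases Nat.even_or_odd n with he | ho
  · exact (sctWardWeak_three_iff S Δ n).2
      (stub_wardOfWardDir n (S n) Δ (EuclideanSpace.single 0 1) single_zero_one_ne_zero (heuc.2 n) (hK1 n hn4 he))
  · exact stub_wardLowLevels ρ Δ S hlim hnorm heuc hsc n (Or.inr ho)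

/-! ## 7⁗ ⇒ 7″ (v10's registered signature, DERIVED) ⇒ 7′ ⇒ item 1982; the compositions concluding the crux BY NAME -/

/-- **7″ `stub_interiorWardUpgradeStrict` of v9/v10, DERIVED from 7⁗.** [cite: FrancescoMathieuSenechal1997, §4.3.1 (4.51)–(4.54)] -/
theorem stub_interiorWardUpgradeStrict :
    ∀ (ρ : ℝ → ℝ) (Δ : ℝ) (S : CorrFamily 3), (∀ δ ∈ Set.Ioc (0:ℝ) 1, 0 < ρ δ) →
      HasPointwiseScalingLimit (criticalCorr 3) ρ S → (∀ n z, z ∉ NonCoincident 3 n → S n z = 0) →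
      IsNondegenerateTwoPoint S → IsEuclideanInvariant S → IsScaleCovariant Δ S →
      1 / 2 < Δ → Δ ≤ 3 / 4 → HasNontrivialU4 S →
      (∀ τ : Fin 3, PointwiseOSReconstruction τ S) →
      (∀ (n m : ℕ) (x : Fin n → EuclideanSpace ℝ (Fin 3)) (y : Fin m → EuclideanSpace ℝ (Fin 3))
        (v : EuclideanSpace ℝ (Fin 3)), v ≠ 0 →
        Tendsto (fun t : ℝ => S (n + m) (Fin.append x (fun j => y j + t • v)) - S n x * S m y)
          atTop (𝓝 0)) →
      ∀ n, SCTWardWeak S Δ n :=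
  fun ρ Δ S hρ hlim hnorm hnd heuc hsc hlt hle hU4 hos hcl =>
    sctWardWeak_all_of_k1EvenGeFour hlim hnorm heuc hsc
      (stub_interiorWardK1EvenGeFour ρ Δ S hρ hlim hnorm hnd heuc hsc hlt hle hU4 hos hcl)

/-- **7′ `stub_interiorInversionUpgradeStrict` of v8, DERIVED from 7″ (hence from 7⁗).** [cite: FrancescoMathieuSenechal1997, §4.3.1 eq. (4.62)] -/
theorem stub_interiorInversionUpgradeStrict :
    ∀ (ρ : ℝ → ℝ) (Δ : ℝ) (S : CorrFamily 3), (∀ δ ∈ Set.Ioc (0:ℝ) 1, 0 < ρ δ) →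
      HasPointwiseScalingLimit (criticalCorr 3) ρ S → (∀ n z, z ∉ NonCoincident 3 n → S n z = 0) →
      IsNondegenerateTwoPoint S → IsEuclideanInvariant S → IsScaleCovariant Δ S →
      1 / 2 < Δ → Δ ≤ 3 / 4 → HasNontrivialU4 S →
      (∀ τ : Fin 3, PointwiseOSReconstruction τ S) →
      (∀ (n m : ℕ) (x : Fin n → EuclideanSpace ℝ (Fin 3)) (y : Fin m → EuclideanSpace ℝ (Fin 3))
        (v : EuclideanSpace ℝ (Fin 3)), v ≠ 0 →
        Tendsto (fun t : ℝ => S (n + m) (Fin.append x (fun j => y j + t • v)) - S n x * S m y)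
          atTop (𝓝 0)) →
      IsInversionCovariant Δ S :=
  fun ρ Δ S hρ hlim hnorm hnd heuc hsc hlt hle hU4 hos hcl =>
    (isMoebiusCovariant_of_limit_of_sctWardWeak hlim hnorm heuc
      (stub_interiorWardUpgradeStrict ρ Δ S hρ hlim hnorm hnd heuc hsc hlt hle hU4 hos hcl)).isInversionCovariant

/-- **1982's STUB 7 `stub_interiorInversionUpgrade` — VERBATIM signature, DERIVED** (edge `U₄ ≢ 0 ⇒ 1/2 < Δ` landed). [folklore] -/
theorem stub_interiorInversionUpgrade :
    ∀ (ρ : ℝ → ℝ) (Δ : ℝ) (S : CorrFamily 3), (∀ δ ∈ Set.Ioc (0:ℝ) 1, 0 < ρ δ) →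
      HasPointwiseScalingLimit (criticalCorr 3) ρ S → (∀ n z, z ∉ NonCoincident 3 n → S n z = 0) →
      IsNondegenerateTwoPoint S → IsEuclideanInvariant S → IsScaleCovariant Δ S →
      1 / 2 ≤ Δ → Δ ≤ 3 / 4 → HasNontrivialU4 S →
      (∀ τ : Fin 3, PointwiseOSReconstruction τ S) →
      (∀ (n m : ℕ) (x : Fin n → EuclideanSpace ℝ (Fin 3)) (y : Fin m → EuclideanSpace ℝ (Fin 3))
        (v : EuclideanSpace ℝ (Fin 3)), v ≠ 0 →
        Tendsto (fun t : ℝ => S (n + m) (Fin.append x (fun j => y j + t • v)) - S n x * S m y)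
          atTop (𝓝 0)) →
      IsInversionCovariant Δ S :=
  fun ρ Δ S hρ hlim hnorm hnd heuc hsc _ hle hU4 hos hcl =>
    stub_interiorInversionUpgradeStrict ρ Δ S hρ hlim hnorm hnd heuc hsc
      (MoebiusLimitExistsSketch.half_lt_delta_of_hasNontrivialU4 hρ hlim hnorm hnd heuc hsc hU4) hle hU4 hos hcl

/-- **T = item stmt-1982, DERIVED from 7″** (landed `inversionUpgradeNormalised_of_interiorStrict`). [folklore] -/
theorem inversionUpgradeNormalised_of_line : Theses.HyperoctahedralRP.InversionUpgradeNormalised :=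
  MoebiusLimitExistsSketch.inversionUpgradeNormalised_of_interiorStrict stub_interiorInversionUpgradeStrict

/-- **The line concludes the crux BY NAME.**  Entry item stmt-1981 + stub 7″ ⇒ `Theses.PerfectScreening.MoebiusLimitExists`
(two-leaf glue p137285 ∘ reduction p139739 ∘ the door). [folklore] -/
theorem MoebiusLimitExists_of (hE : Theses.HyperoctahedralRP.ExistsScaleCovariantLimit) :
    Theses.PerfectScreening.MoebiusLimitExists :=
  MoebiusLimitExistsSketch.MoebiusLimitExists_of_existence_of_interiorStrict hE stub_interiorInversionUpgradeStrict

/-- The primary host route's spelling `Theses.EnergyNotSigmaSquared.MoebiusLimit` (same term). [folklore] -/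
theorem MoebiusLimit_of (hE : Theses.HyperoctahedralRP.ExistsScaleCovariantLimit) :
    Theses.EnergyNotSigmaSquared.MoebiusLimit :=
  MoebiusLimitExists_of hE

/-- Route PlantedPinning's spelling, BY NAME. [folklore] -/
theorem plantedPinning_MoebiusLimitExists_of (hE : Theses.HyperoctahedralRP.ExistsScaleCovariantLimit) :
    Theses.PlantedPinning.MoebiusLimitExists :=
  MoebiusLimitExists_of hE

/-- Route LeeYangGap's spelling, BY NAME. [folklore] -/
theorem leeYangGap_MoebiusLimitExists_of (hE : Theses.HyperoctahedralRP.ExistsScaleCovariantLimit) :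
    Theses.LeeYangGap.MoebiusLimitExists :=
  MoebiusLimitExists_of hE

/-- Route SubPtolemyInterlacing's spelling (decl `MoebiusLimit`), BY NAME. [folklore] -/
theorem subPtolemyInterlacing_MoebiusLimit_of (hE : Theses.HyperoctahedralRP.ExistsScaleCovariantLimit) :
    Theses.SubPtolemyInterlacing.MoebiusLimit :=
  MoebiusLimitExists_of hE

/-- Route CoerciveSharpness's spelling (decl `MoebiusLimit`, this seat's route), BY NAME (v28, lead c21). [folklore] -/
theorem coerciveSharpness_MoebiusLimit_of (hE : Theses.HyperoctahedralRP.ExistsScaleCovariantLimit) :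
    Theses.CoerciveSharpness.MoebiusLimit :=
  MoebiusLimitExists_of hE

/-- Route AnomalousForcesInteraction's spelling (decl `MoebiusLimit`), BY NAME (v28, lead c21). [folklore] -/
theorem anomalousForcesInteraction_MoebiusLimit_of (hE : Theses.HyperoctahedralRP.ExistsScaleCovariantLimit) :
    Theses.AnomalousForcesInteraction.MoebiusLimit :=
  MoebiusLimitExists_of hE

/-- Route GammaForcesInteraction's spelling (decl `MoebiusLimit`), BY NAME (v28, lead c21). [folklore] -/
theorem gammaForcesInteraction_MoebiusLimit_of (hE : Theses.HyperoctahedralRP.ExistsScaleCovariantLimit) :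
    Theses.GammaForcesInteraction.MoebiusLimit :=
  MoebiusLimitExists_of hE

/-- Route DiracCensus's spelling (decl `MoebiusLimitExists`), BY NAME (v28, lead c21). [folklore] -/
theorem diracCensus_MoebiusLimitExists_of (hE : Theses.HyperoctahedralRP.ExistsScaleCovariantLimit) :
    Theses.DiracCensus.MoebiusLimitExists :=
  MoebiusLimitExists_of hE

/-! ## The converse door F = F2 ∘ F1 ∘ F0 and TIGHTNESS -/

/-- **Möbius covariance ⇒ weak special-conformal Ward identities** (translations + unit inversion + continuity suffice):
composition of the three analysis stubs F0, F1, F2. [cite: FrancescoMathieuSenechal1997, §4.3.1 (4.51)–(4.54)] -/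
theorem sctWardWeak_of_moebius {Δ : ℝ} {S : CorrFamily 3} (hcont : ∀ n, ContinuousOn (S n) (NonCoincident 3 n))
    (htr : IsTranslationInvariant S) (hinv : IsInversionCovariant Δ S) : ∀ n, SCTWardWeak S Δ n :=
  fun n => (sctWardWeak_three_iff S Δ n).2
    (stub_wardOfWardOnU0 n (S n) Δ (hcont n) (htr n)
      (stub_wardOnU0 n (S n) Δ (hcont n) (hinv n) (stub_weakTranslation n (S n) (hcont n) (htr n))))

/-- **The crux implies 7″** (crux ⇒ 1982 landed p114842, then F). [cite: FrancescoMathieuSenechal1997, §4.3.1 eq. (4.56)] -/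
theorem wardStub_of_crux (h : Theses.PerfectScreening.MoebiusLimitExists) :
    ∀ (ρ : ℝ → ℝ) (Δ : ℝ) (S : CorrFamily 3), (∀ δ ∈ Set.Ioc (0:ℝ) 1, 0 < ρ δ) →
      HasPointwiseScalingLimit (criticalCorr 3) ρ S → (∀ n z, z ∉ NonCoincident 3 n → S n z = 0) →
      IsNondegenerateTwoPoint S → IsEuclideanInvariant S → IsScaleCovariant Δ S →
      1 / 2 < Δ → Δ ≤ 3 / 4 → HasNontrivialU4 S →
      (∀ τ : Fin 3, PointwiseOSReconstruction τ S) →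
      (∀ (n m : ℕ) (x : Fin n → EuclideanSpace ℝ (Fin 3)) (y : Fin m → EuclideanSpace ℝ (Fin 3))
        (v : EuclideanSpace ℝ (Fin 3)), v ≠ 0 →
        Tendsto (fun t : ℝ => S (n + m) (Fin.append x (fun j => y j + t • v)) - S n x * S m y)
          atTop (𝓝 0)) →
      ∀ n, SCTWardWeak S Δ n :=
  fun ρ Δ S hρ hlim hnorm hnd heuc hsc _ _ _ _ _ =>
    sctWardWeak_of_moebius (LimitMeshContinuity.continuousOn_limit hlim) heuc.1
      (MoebiusLimitExistsOnlyInteraction.inversionUpgradeNormalised_of_MoebiusLimitExists h ρ Δ S hρ hlim hnorm hnd heuc hsc)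

/-- **TIGHTNESS**: the crux is EXACTLY entry ∧ stub 7″, so 7″ is necessary and no reshape can drop content. [folklore] -/
theorem crux_iff_entry_and_wardStub :
    Theses.PerfectScreening.MoebiusLimitExists ↔
      Theses.HyperoctahedralRP.ExistsScaleCovariantLimit ∧
      (∀ (ρ : ℝ → ℝ) (Δ : ℝ) (S : CorrFamily 3), (∀ δ ∈ Set.Ioc (0:ℝ) 1, 0 < ρ δ) →
        HasPointwiseScalingLimit (criticalCorr 3) ρ S → (∀ n z, z ∉ NonCoincident 3 n → S n z = 0) →
        IsNondegenerateTwoPoint S → IsEuclideanInvariant S → IsScaleCovariant Δ S →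
        1 / 2 < Δ → Δ ≤ 3 / 4 → HasNontrivialU4 S →
        (∀ τ : Fin 3, PointwiseOSReconstruction τ S) →
        (∀ (n m : ℕ) (x : Fin n → EuclideanSpace ℝ (Fin 3)) (y : Fin m → EuclideanSpace ℝ (Fin 3))
          (v : EuclideanSpace ℝ (Fin 3)), v ≠ 0 →
          Tendsto (fun t : ℝ => S (n + m) (Fin.append x (fun j => y j + t • v)) - S n x * S m y)
            atTop (𝓝 0)) →
        ∀ n, SCTWardWeak S Δ n) :=
  ⟨fun h => ⟨MoebiusLimitExistsOnlyInteraction.existsScaleCovariantLimit_of_MoebiusLimitExists h, wardStub_of_crux h⟩,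
    fun ⟨hE, h7⟩ => MoebiusLimitExistsSketch.MoebiusLimitExists_of_existence_of_interiorStrict hE
      fun ρ Δ S hρ hlim hnorm hnd heuc hsc hlt hle hU4 hos hcl =>
        (isMoebiusCovariant_of_limit_of_sctWardWeak hlim hnorm heuc
          (h7 ρ Δ S hρ hlim hnorm hnd heuc hsc hlt hle hU4 hos hcl)).isInversionCovariant⟩

/-- **Item 1982 ⟺ the bare Ward upgrade** (7″ without the window / `U₄` / OS / clustering hypotheses is also equivalent: 1982 ⇒ Ward
by F, Ward ⇒ 1982 by the door). [cite: FrancescoMathieuSenechal1997, §4.3.1 eq. (4.62)] -/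
theorem inversionUpgradeNormalised_iff_wardUpgrade :
    Theses.HyperoctahedralRP.InversionUpgradeNormalised ↔
      (∀ (ρ : ℝ → ℝ) (Δ : ℝ) (S : CorrFamily 3), (∀ δ ∈ Set.Ioc (0:ℝ) 1, 0 < ρ δ) →
        HasPointwiseScalingLimit (criticalCorr 3) ρ S → (∀ n z, z ∉ NonCoincident 3 n → S n z = 0) →
        IsNondegenerateTwoPoint S → IsEuclideanInvariant S → IsScaleCovariant Δ S → ∀ n, SCTWardWeak S Δ n) :=
  ⟨fun h ρ Δ S hρ hlim hnorm hnd heuc hsc =>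
      sctWardWeak_of_moebius (LimitMeshContinuity.continuousOn_limit hlim) heuc.1 (h ρ Δ S hρ hlim hnorm hnd heuc hsc),
    fun hW ρ Δ S hρ hlim hnorm hnd heuc hsc =>
      (isMoebiusCovariant_of_limit_of_sctWardWeak hlim hnorm heuc (hW ρ Δ S hρ hlim hnorm hnd heuc hsc)).isInversionCovariant⟩


/-- **The crux implies 7⁗** (crux ⇒ 7″, then specialise to `b = e₀` and even `n ≥ 4`): 7⁗ is necessary. [cite: FrancescoMathieuSenechal1997, §4.3.1 eq. (4.56)] -/
theorem k1Stub_of_crux (h : Theses.PerfectScreening.MoebiusLimitExists) :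
    ∀ (ρ : ℝ → ℝ) (Δ : ℝ) (S : CorrFamily 3), (∀ δ ∈ Set.Ioc (0:ℝ) 1, 0 < ρ δ) →
      HasPointwiseScalingLimit (criticalCorr 3) ρ S → (∀ n z, z ∉ NonCoincident 3 n → S n z = 0) →
      IsNondegenerateTwoPoint S → IsEuclideanInvariant S → IsScaleCovariant Δ S →
      1 / 2 < Δ → Δ ≤ 3 / 4 → HasNontrivialU4 S →
      (∀ τ : Fin 3, PointwiseOSReconstruction τ S) →
      (∀ (n m : ℕ) (x : Fin n → EuclideanSpace ℝ (Fin 3)) (y : Fin m → EuclideanSpace ℝ (Fin 3))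
        (v : EuclideanSpace ℝ (Fin 3)), v ≠ 0 →
        Tendsto (fun t : ℝ => S (n + m) (Fin.append x (fun j => y j + t • v)) - S n x * S m y)
          atTop (𝓝 0)) →
      ∀ n, 4 ≤ n → Even n → ∀ (φ : (Fin n → EuclideanSpace ℝ (Fin 3)) → ℝ),
        ContDiff ℝ ((⊤ : ℕ∞) : WithTop ℕ∞) φ → HasCompactSupport φ → tsupport φ ⊆ NonCoincident 3 n →
        ∫ x, S n x * ((2 * Δ - 6) * (∑ i, inner ℝ (EuclideanSpace.single 0 1 : EuclideanSpace ℝ (Fin 3)) (x i)) * φ x +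
          fderiv ℝ φ x (fun i => ‖x i‖ ^ 2 • (EuclideanSpace.single 0 1 : EuclideanSpace ℝ (Fin 3)) -
            (2 * inner ℝ (EuclideanSpace.single 0 1 : EuclideanSpace ℝ (Fin 3)) (x i)) • x i)) = 0 :=
  fun ρ Δ S hρ hlim hnorm hnd heuc hsc hlt hle hU4 hos hcl n _ _ φ hφ hφc hφU =>
    (sctWardWeak_three_iff S Δ n).1 (wardStub_of_crux h ρ Δ S hρ hlim hnorm hnd heuc hsc hlt hle hU4 hos hcl n)
      (EuclideanSpace.single 0 1) φ hφ hφc hφU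

/-- **TIGHTNESS of v11**: the crux is EXACTLY entry ∧ stub 7⁗ (through the free stubs W0, W1 and the door), so the reshape
7″ → 7⁗ drops no content and 7⁗ is necessary. [folklore] -/
theorem crux_iff_entry_and_k1Stub :
    Theses.PerfectScreening.MoebiusLimitExists ↔
      Theses.HyperoctahedralRP.ExistsScaleCovariantLimit ∧
      (∀ (ρ : ℝ → ℝ) (Δ : ℝ) (S : CorrFamily 3), (∀ δ ∈ Set.Ioc (0:ℝ) 1, 0 < ρ δ) →
      HasPointwiseScalingLimit (criticalCorr 3) ρ S → (∀ n z, z ∉ NonCoincident 3 n → S n z = 0) →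
      IsNondegenerateTwoPoint S → IsEuclideanInvariant S → IsScaleCovariant Δ S →
      1 / 2 < Δ → Δ ≤ 3 / 4 → HasNontrivialU4 S →
      (∀ τ : Fin 3, PointwiseOSReconstruction τ S) →
      (∀ (n m : ℕ) (x : Fin n → EuclideanSpace ℝ (Fin 3)) (y : Fin m → EuclideanSpace ℝ (Fin 3))
        (v : EuclideanSpace ℝ (Fin 3)), v ≠ 0 →
        Tendsto (fun t : ℝ => S (n + m) (Fin.append x (fun j => y j + t • v)) - S n x * S m y)
          atTop (𝓝 0)) →
      ∀ n, 4 ≤ n → Even n → ∀ (φ : (Fin n → EuclideanSpace ℝ (Fin 3)) → ℝ),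
        ContDiff ℝ ((⊤ : ℕ∞) : WithTop ℕ∞) φ → HasCompactSupport φ → tsupport φ ⊆ NonCoincident 3 n →
        ∫ x, S n x * ((2 * Δ - 6) * (∑ i, inner ℝ (EuclideanSpace.single 0 1 : EuclideanSpace ℝ (Fin 3)) (x i)) * φ x +
          fderiv ℝ φ x (fun i => ‖x i‖ ^ 2 • (EuclideanSpace.single 0 1 : EuclideanSpace ℝ (Fin 3)) -
            (2 * inner ℝ (EuclideanSpace.single 0 1 : EuclideanSpace ℝ (Fin 3)) (x i)) • x i)) = 0) :=
  ⟨fun h => ⟨MoebiusLimitExistsOnlyInteraction.existsScaleCovariantLimit_of_MoebiusLimitExists h, k1Stub_of_crux h⟩,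
    fun ⟨hE, h7⟩ => MoebiusLimitExistsSketch.MoebiusLimitExists_of_existence_of_interiorStrict hE
      fun ρ Δ S hρ hlim hnorm hnd heuc hsc hlt hle hU4 hos hcl =>
        (isMoebiusCovariant_of_limit_of_sctWardWeak hlim hnorm heuc
          (sctWardWeak_all_of_k1EvenGeFour hlim hnorm heuc hsc
            (h7 ρ Δ S hρ hlim hnorm hnd heuc hsc hlt hle hU4 hos hcl))).isInversionCovariant⟩


/-! ## The lattice entrance (v11b): 7⁗_lat ⇒ 7⁗, and the census line crux ⟺ 1981 ∧ 7⁗_lat (twin instance B, p152646/p153032) -/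

open Summit.CriticalPhenomena.Ising3DConformalLimit.MoebiusLimitExistsLatticeWard (k1Ward_iff_latticeK1Ward)

/-- **7⁗ from its LATTICE form 7⁗_lat** — the door a discrete `K₁` Ward identity on `ℤ³` would enter by: if for every limit as in 7⁗
the rescaled critical correlators satisfy the single-generator weak Ward identities ASYMPTOTICALLY at the even levels `n ≥ 4`
(`∫ ρ(δ)ⁿ⟨σ_[x₁/δ]⋯σ_[xₙ/δ]⟩ 𝒦ᵀ_{e₀}φ → 0`), then 7⁗ holds (`k1Ward_iff_latticeK1Ward`, dominated convergence on the compact support).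
[cite: FrancescoMathieuSenechal1997, §4.3.1 (4.51)–(4.54)] -/
theorem stub_interiorWardK1EvenGeFour_of_lattice
    (hlat :
  ∀ (ρ : ℝ → ℝ) (Δ : ℝ) (S : CorrFamily 3), (∀ δ ∈ Set.Ioc (0:ℝ) 1, 0 < ρ δ) →
      HasPointwiseScalingLimit (criticalCorr 3) ρ S → (∀ n z, z ∉ NonCoincident 3 n → S n z = 0) →
      IsNondegenerateTwoPoint S → IsEuclideanInvariant S → IsScaleCovariant Δ S →
      1 / 2 < Δ → Δ ≤ 3 / 4 → HasNontrivialU4 S →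
      (∀ τ : Fin 3, PointwiseOSReconstruction τ S) →
      (∀ (n m : ℕ) (x : Fin n → EuclideanSpace ℝ (Fin 3)) (y : Fin m → EuclideanSpace ℝ (Fin 3))
        (v : EuclideanSpace ℝ (Fin 3)), v ≠ 0 →
        Tendsto (fun t : ℝ => S (n + m) (Fin.append x (fun j => y j + t • v)) - S n x * S m y)
          atTop (𝓝 0)) →
      ∀ n, 4 ≤ n → Even n → ∀ (φ : (Fin n → EuclideanSpace ℝ (Fin 3)) → ℝ),
        ContDiff ℝ ((⊤ : ℕ∞) : WithTop ℕ∞) φ → HasCompactSupport φ → tsupport φ ⊆ NonCoincident 3 n →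
        Tendsto (fun δ => ∫ x, rescaledCorrelator (criticalCorr 3) ρ n δ x *
            ((2 * Δ - 6) * (∑ i, inner ℝ (EuclideanSpace.single 0 1 : EuclideanSpace ℝ (Fin 3)) (x i)) * φ x +
              fderiv ℝ φ x (fun i => ‖x i‖ ^ 2 • (EuclideanSpace.single 0 1 : EuclideanSpace ℝ (Fin 3)) -
                (2 * inner ℝ (EuclideanSpace.single 0 1 : EuclideanSpace ℝ (Fin 3)) (x i)) • x i)))
          (𝓝[>] (0:ℝ)) (𝓝 0)) :
    ∀ (ρ : ℝ → ℝ) (Δ : ℝ) (S : CorrFamily 3), (∀ δ ∈ Set.Ioc (0:ℝ) 1, 0 < ρ δ) →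
      HasPointwiseScalingLimit (criticalCorr 3) ρ S → (∀ n z, z ∉ NonCoincident 3 n → S n z = 0) →
      IsNondegenerateTwoPoint S → IsEuclideanInvariant S → IsScaleCovariant Δ S →
      1 / 2 < Δ → Δ ≤ 3 / 4 → HasNontrivialU4 S →
      (∀ τ : Fin 3, PointwiseOSReconstruction τ S) →
      (∀ (n m : ℕ) (x : Fin n → EuclideanSpace ℝ (Fin 3)) (y : Fin m → EuclideanSpace ℝ (Fin 3))
        (v : EuclideanSpace ℝ (Fin 3)), v ≠ 0 →
        Tendsto (fun t : ℝ => S (n + m) (Fin.append x (fun j => y j + t • v)) - S n x * S m y)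
          atTop (𝓝 0)) →
      ∀ n, 4 ≤ n → Even n → ∀ (φ : (Fin n → EuclideanSpace ℝ (Fin 3)) → ℝ),
        ContDiff ℝ ((⊤ : ℕ∞) : WithTop ℕ∞) φ → HasCompactSupport φ → tsupport φ ⊆ NonCoincident 3 n →
        ∫ x, S n x * ((2 * Δ - 6) * (∑ i, inner ℝ (EuclideanSpace.single 0 1 : EuclideanSpace ℝ (Fin 3)) (x i)) * φ x +
          fderiv ℝ φ x (fun i => ‖x i‖ ^ 2 • (EuclideanSpace.single 0 1 : EuclideanSpace ℝ (Fin 3)) -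
            (2 * inner ℝ (EuclideanSpace.single 0 1 : EuclideanSpace ℝ (Fin 3)) (x i)) • x i)) = 0 :=
  fun ρ Δ S hρ hlim hnorm hnd heuc hsc hlt hle hU4 hos hcl =>
    (k1Ward_iff_latticeK1Ward ρ Δ S hlim).2 (hlat ρ Δ S hρ hlim hnorm hnd heuc hsc hlt hle hU4 hos hcl)

/-- **CENSUS LINE of v11b: crux ⟺ entry ∧ 7⁗_lat** — the crux is EXACTLY item 1981 plus the asymptotic single-generator even-level
LATTICE Ward identities of the critical `ℤ³` correlators along every interacting open-window limit (no limit object in the residual's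
conclusion). [folklore] -/
theorem crux_iff_entry_and_latticeK1Stub :
    Theses.PerfectScreening.MoebiusLimitExists ↔
      Theses.HyperoctahedralRP.ExistsScaleCovariantLimit ∧
      (∀ (ρ : ℝ → ℝ) (Δ : ℝ) (S : CorrFamily 3), (∀ δ ∈ Set.Ioc (0:ℝ) 1, 0 < ρ δ) →
      HasPointwiseScalingLimit (criticalCorr 3) ρ S → (∀ n z, z ∉ NonCoincident 3 n → S n z = 0) →
      IsNondegenerateTwoPoint S → IsEuclideanInvariant S → IsScaleCovariant Δ S →
      1 / 2 < Δ → Δ ≤ 3 / 4 → HasNontrivialU4 S →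
      (∀ τ : Fin 3, PointwiseOSReconstruction τ S) →
      (∀ (n m : ℕ) (x : Fin n → EuclideanSpace ℝ (Fin 3)) (y : Fin m → EuclideanSpace ℝ (Fin 3))
        (v : EuclideanSpace ℝ (Fin 3)), v ≠ 0 →
        Tendsto (fun t : ℝ => S (n + m) (Fin.append x (fun j => y j + t • v)) - S n x * S m y)
          atTop (𝓝 0)) →
      ∀ n, 4 ≤ n → Even n → ∀ (φ : (Fin n → EuclideanSpace ℝ (Fin 3)) → ℝ),
        ContDiff ℝ ((⊤ : ℕ∞) : WithTop ℕ∞) φ → HasCompactSupport φ → tsupport φ ⊆ NonCoincident 3 n →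
        Tendsto (fun δ => ∫ x, rescaledCorrelator (criticalCorr 3) ρ n δ x *
            ((2 * Δ - 6) * (∑ i, inner ℝ (EuclideanSpace.single 0 1 : EuclideanSpace ℝ (Fin 3)) (x i)) * φ x +
              fderiv ℝ φ x (fun i => ‖x i‖ ^ 2 • (EuclideanSpace.single 0 1 : EuclideanSpace ℝ (Fin 3)) -
                (2 * inner ℝ (EuclideanSpace.single 0 1 : EuclideanSpace ℝ (Fin 3)) (x i)) • x i)))
          (𝓝[>] (0:ℝ)) (𝓝 0)) := by
  rw [crux_iff_entry_and_k1Stub]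
  refine and_congr_right fun _ => ?_
  refine forall_congr' fun ρ => forall_congr' fun Δ => forall_congr' fun S => forall_congr' fun _ =>
    forall_congr' fun hlim => ?_
  exact forall_congr' fun _ => forall_congr' fun _ => forall_congr' fun _ => forall_congr' fun _ =>
    forall_congr' fun _ => forall_congr' fun _ => forall_congr' fun _ => forall_congr' fun _ =>
    forall_congr' fun _ => k1Ward_iff_latticeK1Ward ρ Δ S hlim

end Summit.CriticalPhenomena.Ising3DConformalLimit.MoebiusLimitExistsSketchV11

end
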